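import Literature.Computability.Complexity.HardcoreInapproximabilitySecondMomentGeneral
import Literature.Computability.MetaComplexity.LevelledRefutationCNFProofs
import Literature.Probability.RandomGraphs.RandomRamseyProofs
import HarnessLib

/-!
# The second moment of Sly's slice partition function: the limit form

From the explicit bound `slyRatioGen_le_explicit` to the `ε`–`n₀` statement `slyRatioGen_le_tau`:
for every `ε > 0` there are a window `χ > 0` and `n₀` such that for `n ≥ n₀`, `m' ≤ n^{1/10}`
boundary vertices with any numbers of occupied ports, and slice densities within `χ` of the fixed
point `(p⁺, p⁻)`, `E[Z_{a,b}(η)²]/(E Z_{a,b}(η))² ≤ (1 + ε) τ`, `τ = (1-q²ρ²)^{-1/2}(1-ρ²)^{-q/2}`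
(`d = q + 1` matchings). Ingredients: continuity of the main constant at the fixed point
(`continuousAt_slyMainConst`, by `fun_prop` with an inline positivity discharger for the open simplex), majorants of
the error factor and of the far part with their limits (`tendsto_slyErrU`, `tendsto_slyFarU`), and
the bookkeeping of the uniform constants (Hessian `κ`, cone radius `r₀`, gap `η`, window `w =
n^{-2/5}`, Stirling margin `μ ≍ n`).

## References
* [Sly2010] A. Sly, FOCS 2010 / arXiv:1005.5584, Lemma 3.5 and proof of Theorem 3.10.
* [MosselWeitzWormald2008] E. Mossel, D. Weitz, N. Wormald, PTRF 143 (2009), Theorem 6.11.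
-/

namespace Literature.Computability.Complexity

open Real Finset Filter Topology Literature.Analysis.SpecialFunctions Literature.Probability.LatticeModels

section Constants

variable {α β : ℝ}

/-- `KB = e^{Pref_B(c*)/2} κ₃^{-1/2} = (1-ρ²)^{-1/2} ≥ 1`. [folklore] -/
theorem one_le_slyKB (hα : 0 < α) (hβ : 0 < β) (hαβ : α + β < 1) :
    1 ≤ Real.exp (slyPrefB α β (α ^ 2) (β ^ 2) (α * (1 - α - β)) / 2) / Real.sqrt (slyK3 α β) := by
  have hκ := slyK3_pos hα hβ hαβ
  have hid := exp_slyPrefB_mul hα hβ hαβ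
  have hρ := slyRho_sq_lt_one hα hβ hαβ
  set ρ2 := (α * β / ((1 - α) * (1 - β))) ^ 2 with hρ2
  have hρ0 : 0 ≤ ρ2 := by positivity
  -- `e^{P} = κ₃/(1-ρ²) ≥ κ₃`
  have hexp : slyK3 α β ≤ Real.exp (slyPrefB α β (α ^ 2) (β ^ 2) (α * (1 - α - β))) := by
    have h1 : Real.exp (slyPrefB α β (α ^ 2) (β ^ 2) (α * (1 - α - β))) * (1 - ρ2) ≤
        Real.exp (slyPrefB α β (α ^ 2) (β ^ 2) (α * (1 - α - β))) * 1 :=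
      mul_le_mul_of_nonneg_left (by linarith) (Real.exp_pos _).le
    rw [mul_one] at h1; linarith [hid]
  rw [le_div_iff₀ (Real.sqrt_pos.mpr hκ), one_mul, Real.exp_half]
  exact Real.sqrt_le_sqrt hexp

/-- `κ₃ ≤ 2/m₀⁵` when all cells are at least `m₀`. [folklore] -/
theorem slyK3_le (hα : 0 < α) (hβ : 0 < β) (hαβ : α + β < 1) {m₀ : ℝ} (hm₀ : 0 < m₀)
    (hαm : m₀ ≤ α) (hβm : m₀ ≤ β) (hsm : m₀ ≤ 1 - α - β) :
    slyK3 α β ≤ 2 / m₀ ^ 5 := by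
  unfold slyK3
  have h1 : 0 < 1 - α := by linarith
  have h2 : 0 < 1 - β := by linarith
  have h3 : 0 < 1 - α - β := by linarith
  have h1m : m₀ ≤ 1 - α := by linarith
  have h2m : m₀ ≤ 1 - β := by linarith
  have hab : 0 ≤ α * β := by positivity
  have habc : 0 ≤ α * β * (1 - α) := mul_nonneg hab h1.le
  have habcd : 0 ≤ α * β * (1 - α) * (1 - β) := mul_nonneg habc h2.le
  have hden : m₀ ^ 5 ≤ α * β * (1 - α) * (1 - β) * (1 - α - β) := by
    have s2 : m₀ * m₀ ≤ α * β := mul_le_mul hαm hβm hm₀.le hα.le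
    have s3 : m₀ * m₀ * m₀ ≤ α * β * (1 - α) := mul_le_mul s2 h1m hm₀.le hab
    have s4 : m₀ * m₀ * m₀ * m₀ ≤ α * β * (1 - α) * (1 - β) := mul_le_mul s3 h2m hm₀.le habc
    have s5 : m₀ * m₀ * m₀ * m₀ * m₀ ≤ α * β * (1 - α) * (1 - β) * (1 - α - β) :=
      mul_le_mul s4 hsm hm₀.le habcd
    calc m₀ ^ 5 = m₀ * m₀ * m₀ * m₀ * m₀ := by ring
      _ ≤ _ := s5
  have hnum : 1 - α - β + 2 * α * β ≤ 2 := by nlinarith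
  have hden0 : 0 < α * β * (1 - α) * (1 - β) * (1 - α - β) :=
    mul_pos (mul_pos (mul_pos (mul_pos hα hβ) h1) h2) h3
  rw [div_le_div_iff₀ hden0 (by positivity)]
  have h5 : 0 ≤ m₀ ^ 5 := by positivity
  nlinarith [mul_le_mul_of_nonneg_right hnum h5, hden]

end Constants

section MainConst

/-- `KB(α,β) = e^{Pref_B(c*)/2} κ₃^{-1/2}`, the colour prefactor constant. [folklore] -/
noncomputable def slyKB (α β : ℝ) : ℝ :=
  Real.exp (slyPrefB α β (α ^ 2) (β ^ 2) (α * (1 - α - β)) / 2) / Real.sqrt (slyK3 α β)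

/-- The determinant of the combined planar lattice form. [folklore] -/
noncomputable def slyDt (q : ℕ) (θ α β α' β' : ℝ) : ℝ :=
  slySAgen q θ α β α' β' * slySCgen q θ α β α' β' - slySBgen q θ α β α' β' ^ 2

/-- **The main constant** of the explicit second-moment bound as a function of
`z = (α, β, α', β', θ)`: `e^{Pref_A(α,β)/2} KB(α',β')^q KB(α,β) / √D_t`. [cite: Sly2010, Lemma 3.5] -/
noncomputable def slyMainConst (q : ℕ) (z : ℝ × ℝ × ℝ × ℝ × ℝ) : ℝ :=
  Real.exp (slyPrefA z.1 z.2.1 (z.1 ^ 2) (z.2.1 ^ 2) / 2) * slyKB z.2.2.1 z.2.2.2.1 ^ q * slyKB z.1 z.2.1 /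
    Real.sqrt (slyDt q z.2.2.2.2 z.1 z.2.1 z.2.2.1 z.2.2.2.1)

variable {q : ℕ} {pp pm : ℝ}

/-- `slyDt` at `θ = 1`. [folklore] -/
theorem slyDt_one_eq (q : ℕ) (α β : ℝ) :
    slyDt q 1 α β α β = slySA (q + 1) α β * slySC (q + 1) α β - slySB (q + 1) α β ^ 2 := by
  obtain ⟨h1, h2, h3⟩ := slySgen_eq_of_eq (q := q) (α := α) (β := β)
  unfold slyDt; rw [h1, h2, h3]

/-- At equal densities and `θ = 1` the main constant is `τ`. [cite: MosselWeitzWormald2008, Theorem 6.11] -/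
theorem slyMainConst_fixedPoint (hpp : 0 < pp) (hpm : 0 < pm) (hsum : pp + pm < 1)
    (hD : 0 < slySA (q + 1) pp pm * slySC (q + 1) pp pm - slySB (q + 1) pp pm ^ 2) :
    slyMainConst q (pp, pm, pp, pm, 1) = slyTau (q + 1) pp pm := by
  unfold slyMainConst
  dsimp only
  rw [slyDt_one_eq, ← slyTau_eq_prefactors (d := q + 1) (by omega) hpp hpm hsum hD, pow_succ]
  unfold slyKB
  ring

/-- Continuity of the combined determinant. [folklore] -/
theorem continuousAt_slyDt {α β α' β' θ : ℝ} (hα : 0 < α) (hβ : 0 < β) (hαβ : α + β < 1)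
    (hα' : 0 < α') (hβ' : 0 < β') (hαβ' : α' + β' < 1) :
    ContinuousAt (fun z : ℝ × ℝ × ℝ × ℝ × ℝ => slyDt q z.2.2.2.2 z.1 z.2.1 z.2.2.1 z.2.2.2.1)
      (α, β, α', β', θ) := by
  have := mul_pos hα hβ
  have := mul_pos hα' hβ'
  have h1 : 0 < 1 - α := by linarith
  have h2 : 0 < 1 - β := by linarith
  have h3 : 0 < 1 - α - β := by linarith
  have h1' : 0 < 1 - α' := by linarith
  have h2' : 0 < 1 - β' := by linarith
  have h3' : 0 < 1 - α' - β' := by linarith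
  unfold slyDt slySAgen slySBgen slySCgen slyM11 slyM12 slyM22 slyB13 slyB23 slyB11 slyB22 slyK3
  fun_prop (disch := ((try dsimp only); repeat' (first | (apply ne_of_gt; nlinarith) | (apply mul_ne_zero) | (apply inv_ne_zero) | (apply div_ne_zero) | (apply Real.sqrt_ne_zero'.mpr) | (apply div_pos) | (apply inv_pos.mpr) | (apply mul_pos) | nlinarith)))

/-- Continuity of the entries `C_t`, `A_t`. [folklore] -/
theorem continuousAt_slySCgen {α β α' β' θ : ℝ} (hα : 0 < α) (hβ : 0 < β) (hαβ : α + β < 1)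
    (hα' : 0 < α') (hβ' : 0 < β') (hαβ' : α' + β' < 1) :
    ContinuousAt (fun z : ℝ × ℝ × ℝ × ℝ × ℝ => slySCgen q z.2.2.2.2 z.1 z.2.1 z.2.2.1 z.2.2.2.1)
      (α, β, α', β', θ) ∧
    ContinuousAt (fun z : ℝ × ℝ × ℝ × ℝ × ℝ => slySAgen q z.2.2.2.2 z.1 z.2.1 z.2.2.1 z.2.2.2.1)
      (α, β, α', β', θ) := by
  have := mul_pos hα hβ
  have := mul_pos hα' hβ'
  have h1 : 0 < 1 - α := by linarith
  have h2 : 0 < 1 - β := by linarith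
  have h3 : 0 < 1 - α - β := by linarith
  have h1' : 0 < 1 - α' := by linarith
  have h2' : 0 < 1 - β' := by linarith
  have h3' : 0 < 1 - α' - β' := by linarith
  constructor
  · unfold slySCgen slyM22 slyB23 slyB22 slyK3
    fun_prop (disch := ((try dsimp only); repeat' (first | (apply ne_of_gt; nlinarith) | (apply mul_ne_zero) | (apply inv_ne_zero) | (apply div_ne_zero) | (apply Real.sqrt_ne_zero'.mpr) | (apply div_pos) | (apply inv_pos.mpr) | (apply mul_pos) | nlinarith)))
  · unfold slySAgen slyM11 slyB13 slyB11 slyK3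
    fun_prop (disch := ((try dsimp only); repeat' (first | (apply ne_of_gt; nlinarith) | (apply mul_ne_zero) | (apply inv_ne_zero) | (apply div_ne_zero) | (apply Real.sqrt_ne_zero'.mpr) | (apply div_pos) | (apply inv_pos.mpr) | (apply mul_pos) | nlinarith)))

/-- **Continuity of the main constant at the fixed point.** [folklore] -/
theorem continuousAt_slyMainConst (hpp : 0 < pp) (hpm : 0 < pm) (hsum : pp + pm < 1)
    (hD : 0 < slySA (q + 1) pp pm * slySC (q + 1) pp pm - slySB (q + 1) pp pm ^ 2) :
    ContinuousAt (slyMainConst q) (pp, pm, pp, pm, 1) := by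
  have := mul_pos hpp hpm
  have h1 : 0 < 1 - pp := by linarith
  have h2 : 0 < 1 - pm := by linarith
  have h3 : 0 < 1 - pp - pm := by linarith
  have hN : ContinuousAt (fun z : ℝ × ℝ × ℝ × ℝ × ℝ =>
      Real.exp (slyPrefA z.1 z.2.1 (z.1 ^ 2) (z.2.1 ^ 2) / 2) * slyKB z.2.2.1 z.2.2.2.1 ^ q * slyKB z.1 z.2.1)
      (pp, pm, pp, pm, 1) := by
    unfold slyKB slyPrefA slyPrefB slyK3
    fun_prop (disch := ((try dsimp only); repeat' (first | (apply ne_of_gt; nlinarith) | (apply mul_ne_zero) | (apply inv_ne_zero) | (apply div_ne_zero) | (apply Real.sqrt_ne_zero'.mpr) | (apply div_pos) | (apply inv_pos.mpr) | (apply mul_pos) | nlinarith)))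
  have hDc := (continuousAt_slyDt (q := q) (θ := 1) hpp hpm hsum hpp hpm hsum).sqrt
  have hD1 : Real.sqrt (slyDt q 1 pp pm pp pm) ≠ 0 := by
    rw [slyDt_one_eq]; exact Real.sqrt_ne_zero'.mpr hD
  exact hN.div hDc hD1

end MainConst

section Limits

/-- **Stretched-exponential decay beats powers**: `n^k e^{-c n^r} → 0`. [folklore] -/
theorem tendsto_natCast_rpow_mul_exp_neg {k c r : ℝ} (hc : 0 < c) (hr : 0 < r) :
    Tendsto (fun n : ℕ => (n : ℝ) ^ k * Real.exp (-c * (n : ℝ) ^ r)) atTop (𝓝 0) := by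
  have h := (tendsto_rpow_mul_exp_neg_mul_atTop_nhds_zero (k / r) c hc).comp (_root_.Literature.Probability.RandomGraphs.tendsto_natCast_rpow_atTop hr)
  refine h.congr fun n => ?_
  simp only [Function.comp]
  rw [← Real.rpow_mul (Nat.cast_nonneg n), mul_div_cancel₀ _ hr.ne']

/-- `2/(e^{cn} - 1) → 0`. [folklore] -/
theorem tendsto_two_div_exp_sub_one {c : ℝ} (hc : 0 < c) :
    Tendsto (fun n : ℕ => 2 / (Real.exp (c * n) - 1)) atTop (𝓝 0) := by
  have h1 : Tendsto (fun n : ℕ => Real.exp (c * n) - 1) atTop atTop := by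
    apply tendsto_atTop_add_const_right
    exact tendsto_exp_atTop.comp (tendsto_natCast_atTop_atTop.const_mul_atTop hc)
  exact tendsto_const_nhds.div_atTop h1

/-- The boundary slack is eventually dominated: `b n^{1/10}(1 + log 2n) ≤ c n^{1/5}`. [folklore] -/
theorem eventually_boundary_slack_le {b c : ℝ} (hb : 0 ≤ b) (hc : 0 < c) :
    ∀ᶠ n : ℕ in atTop, b * (n : ℝ) ^ (1 / 10 : ℝ) * (1 + Real.log (2 * n)) ≤ c * (n : ℝ) ^ (1 / 5 : ℝ) := by
  have hev := (_root_.Literature.Probability.RandomGraphs.tendsto_natCast_rpow_atTop (c := 1 / 20) (by norm_num)).eventually_ge_atTop (41 * b / c)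
  have hev1 : ∀ᶠ n : ℕ in atTop, 1 ≤ n := eventually_ge_atTop 1
  filter_upwards [hev, hev1] with n hn hn1
  have hnR : (1 : ℝ) ≤ n := by exact_mod_cast hn1
  have hn0 : (0 : ℝ) ≤ n := by linarith
  -- `log (2n) ≤ 40 n^{1/20}`
  have hlog : Real.log (2 * n) ≤ 40 * (n : ℝ) ^ (1 / 20 : ℝ) := by
    have h := Real.log_le_rpow_div (show (0:ℝ) ≤ 2 * n by positivity) (show (0:ℝ) < 1 / 20 by norm_num)
    rw [Real.mul_rpow (by norm_num) hn0] at h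
    have h2 : (2 : ℝ) ^ (1 / 20 : ℝ) ≤ 2 := by
      have : (2 : ℝ) ^ (1 / 20 : ℝ) ≤ (2 : ℝ) ^ (1 : ℝ) :=
        Real.rpow_le_rpow_of_exponent_le (by norm_num) (by norm_num)
      simpa using this
    have h3 : 0 ≤ (n : ℝ) ^ (1 / 20 : ℝ) := by positivity
    calc Real.log (2 * n) ≤ (2 : ℝ) ^ (1 / 20 : ℝ) * (n : ℝ) ^ (1 / 20 : ℝ) / (1 / 20) := h
      _ = 20 * ((2 : ℝ) ^ (1 / 20 : ℝ) * (n : ℝ) ^ (1 / 20 : ℝ)) := by ring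
      _ ≤ 20 * (2 * (n : ℝ) ^ (1 / 20 : ℝ)) := by
          apply mul_le_mul_of_nonneg_left (mul_le_mul_of_nonneg_right h2 h3) (by norm_num)
      _ = 40 * (n : ℝ) ^ (1 / 20 : ℝ) := by ring
  have hone : 1 ≤ (n : ℝ) ^ (1 / 20 : ℝ) := Real.one_le_rpow hnR (by norm_num)
  have h41 : 1 + Real.log (2 * n) ≤ 41 * (n : ℝ) ^ (1 / 20 : ℝ) := by linarith
  -- exponents
  have e1 : (n : ℝ) ^ (1 / 10 : ℝ) * (n : ℝ) ^ (1 / 20 : ℝ) = (n : ℝ) ^ (3 / 20 : ℝ) := by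
    rw [← Real.rpow_add' hn0 (by norm_num)]; norm_num
  have e2 : (n : ℝ) ^ (3 / 20 : ℝ) * (n : ℝ) ^ (1 / 20 : ℝ) = (n : ℝ) ^ (1 / 5 : ℝ) := by
    rw [← Real.rpow_add' hn0 (by norm_num)]; norm_num
  have h10 : 0 ≤ (n : ℝ) ^ (1 / 10 : ℝ) := by positivity
  have h320 : 0 ≤ (n : ℝ) ^ (3 / 20 : ℝ) := by positivity
  calc b * (n : ℝ) ^ (1 / 10 : ℝ) * (1 + Real.log (2 * n))
      ≤ b * (n : ℝ) ^ (1 / 10 : ℝ) * (41 * (n : ℝ) ^ (1 / 20 : ℝ)) :=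
        mul_le_mul_of_nonneg_left h41 (by positivity)
    _ = 41 * b * (n : ℝ) ^ (3 / 20 : ℝ) := by rw [← e1]; ring
    _ ≤ c * (n : ℝ) ^ (1 / 20 : ℝ) * (n : ℝ) ^ (3 / 20 : ℝ) := by
        apply mul_le_mul_of_nonneg_right _ h320
        rw [div_le_iff₀ hc] at hn; linarith
    _ = c * (n : ℝ) ^ (1 / 5 : ℝ) := by rw [← e2]; ring

end Limits

section Majorants

variable (q : ℕ) (mL κ c₀ KU CU AU : ℝ)

/-- Majorant of the overlap-factor error exponent `θ_A`. [folklore] -/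
noncomputable def slyEA (n : ℕ) : ℝ :=
  48 * (n : ℝ) ^ (-(1 / 5 : ℝ)) / mL ^ 4 + 8 * (n : ℝ) ^ (-(2 / 5 : ℝ)) / mL ^ 2 + 8 / (mL ^ 2 * n)

/-- Majorant of the colour error exponent `E₁`. [folklore] -/
noncomputable def slyEB (n : ℕ) : ℝ :=
  2880 * (n : ℝ) ^ (-(1 / 5 : ℝ)) / mL ^ 4 + 38 * (n : ℝ) ^ (-(2 / 5 : ℝ)) / mL ^ 2 + 8 / (mL ^ 2 * n)

/-- Majorant of the colour remainder term. [folklore] -/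
noncomputable def slyRU (n : ℕ) : ℝ :=
  (2 * (n : ℝ) + 1) * Real.exp (-(κ / (2 * ((q : ℝ) + 1))) * (n : ℝ) ^ (1 / 5 : ℝ) +
    5 * (Real.log (2 * n) / 2 + 2))

/-- Majorant of the colour factor `Θ`. [folklore] -/
noncomputable def slyThetaU (n : ℕ) : ℝ :=
  Real.exp (slyEB mL n) * (1 + 2 / (Real.exp (2 * π ^ 2 / KU * n) - 1)) + slyRU q κ n

/-- **Majorant of the total error factor** of the explicit bound. [folklore] -/
noncomputable def slyErrU (n : ℕ) : ℝ :=
  Real.exp (slyEA mL n) * slyThetaU q mL κ KU n ^ q * slyThetaU q mL κ KU n *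
    Real.exp (120 * q * ((3 * ((q : ℝ) + 3) + 6) / mL ^ 5) * c₀ * (n : ℝ) ^ (-(3 / 10 : ℝ))) *
    ((1 + 2 / (Real.exp (2 * π ^ 2 / CU * n) - 1)) * (1 + 2 / (Real.exp (2 * π ^ 2 / AU * n) - 1)))

/-- **Majorant of the far part** of the explicit bound. [folklore] -/
noncomputable def slyFarU (n : ℕ) : ℝ :=
  ((n : ℝ) + 1) ^ 2 * ((2 * (n : ℝ) + 1) ^ q * ((n : ℝ) + 1) *
    Real.exp (5 * q * (Real.log (2 * n) / 2 + 2) + 7 * (Real.log n / 2 + 2) -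
      (n * (κ / 2 * (c₀ * (n : ℝ) ^ (-(2 / 5 : ℝ)) / 8) ^ 2) - 14 * (n : ℝ) ^ (1 / 10 : ℝ) * (1 + Real.log (2 * n)))))

variable {q mL κ c₀ KU CU AU}

/-- `slyEA → 0`. [folklore] -/
theorem tendsto_slyEA : Tendsto (slyEA mL) atTop (𝓝 0) := by
  have h1 := (_root_.Literature.Computability.MetaComplexity.LevelledRefCNF.tendsto_rpow_neg_nat (y := 1 / 5) (by norm_num)).mul_const (48 / mL ^ 4)
  have h2 := (_root_.Literature.Computability.MetaComplexity.LevelledRefCNF.tendsto_rpow_neg_nat (y := 2 / 5) (by norm_num)).mul_const (8 / mL ^ 2)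
  have h3 := tendsto_const_div_atTop_nhds_zero_nat (8 / mL ^ 2)
  have := (h1.add h2).add h3
  simp only [zero_mul, add_zero] at this
  refine this.congr fun n => ?_
  unfold slyEA; ring

/-- `slyEB → 0`. [folklore] -/
theorem tendsto_slyEB : Tendsto (slyEB mL) atTop (𝓝 0) := by
  have h1 := (_root_.Literature.Computability.MetaComplexity.LevelledRefCNF.tendsto_rpow_neg_nat (y := 1 / 5) (by norm_num)).mul_const (2880 / mL ^ 4)
  have h2 := (_root_.Literature.Computability.MetaComplexity.LevelledRefCNF.tendsto_rpow_neg_nat (y := 2 / 5) (by norm_num)).mul_const (38 / mL ^ 2)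
  have h3 := tendsto_const_div_atTop_nhds_zero_nat (8 / mL ^ 2)
  have := (h1.add h2).add h3
  simp only [zero_mul, add_zero] at this
  refine this.congr fun n => ?_
  unfold slyEB; ring

/-- `slyRU → 0`. [folklore] -/
theorem tendsto_slyRU (hκ : 0 < κ) : Tendsto (slyRU q κ) atTop (𝓝 0) := by
  have hq1 : (0 : ℝ) < (q : ℝ) + 1 := by positivity
  set κ' := κ / (2 * ((q : ℝ) + 1)) with hκ'
  have hκ'0 : 0 < κ' := by positivity
  -- squeeze between `0` and `C n^{7/2} e^{-κ' n^{1/5}}`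
  have hup := (tendsto_natCast_rpow_mul_exp_neg (k := 7 / 2) hκ'0 (show (0:ℝ) < 1 / 5 by norm_num)).const_mul
    (3 * 2 ^ (5 / 2 : ℝ) * Real.exp 10)
  rw [mul_zero] at hup
  refine tendsto_of_tendsto_of_tendsto_of_le_of_le' tendsto_const_nhds hup ?_ ?_
  · filter_upwards with n
    unfold slyRU; positivity
  · filter_upwards [eventually_ge_atTop 1] with n hn
    have hnR : (1 : ℝ) ≤ n := by exact_mod_cast hn
    have hn0 : (0 : ℝ) < n := by linarith
    unfold slyRU
    rw [← hκ']
    have e1 : Real.exp (-κ' * (n : ℝ) ^ (1 / 5 : ℝ) + 5 * (Real.log (2 * n) / 2 + 2)) =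
        Real.exp (-κ' * (n : ℝ) ^ (1 / 5 : ℝ)) * ((2 * n) ^ (5 / 2 : ℝ) * Real.exp 10) := by
      rw [Real.rpow_def_of_pos (by positivity : (0:ℝ) < 2 * n)]
      simp only [← Real.exp_add]
      congr 1; ring
    rw [e1, Real.mul_rpow (by norm_num) hn0.le]
    have h2n : 2 * (n : ℝ) + 1 ≤ 3 * n := by linarith
    have h72 : (n : ℝ) ^ (7 / 2 : ℝ) = n * (n : ℝ) ^ (5 / 2 : ℝ) := by
      rw [show (7 / 2 : ℝ) = 1 + 5 / 2 by norm_num, Real.rpow_add hn0, Real.rpow_one]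
    rw [h72]
    have hE : 0 ≤ Real.exp (-κ' * (n : ℝ) ^ (1 / 5 : ℝ)) := (Real.exp_pos _).le
    have hP : 0 ≤ (2 : ℝ) ^ (5 / 2 : ℝ) * (n : ℝ) ^ (5 / 2 : ℝ) * Real.exp 10 := by positivity
    calc (2 * (n : ℝ) + 1) * (Real.exp (-κ' * (n : ℝ) ^ (1 / 5 : ℝ)) *
          ((2 : ℝ) ^ (5 / 2 : ℝ) * (n : ℝ) ^ (5 / 2 : ℝ) * Real.exp 10))
        ≤ (3 * n) * (Real.exp (-κ' * (n : ℝ) ^ (1 / 5 : ℝ)) *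
          ((2 : ℝ) ^ (5 / 2 : ℝ) * (n : ℝ) ^ (5 / 2 : ℝ) * Real.exp 10)) :=
          mul_le_mul_of_nonneg_right h2n (mul_nonneg hE hP)
      _ = 3 * 2 ^ (5 / 2 : ℝ) * Real.exp 10 * (n * (n : ℝ) ^ (5 / 2 : ℝ) * Real.exp (-κ' * (n : ℝ) ^ (1 / 5 : ℝ))) := by
          ring

/-- `slyThetaU → 0`. [folklore] -/
theorem tendsto_slyThetaU (hκ : 0 < κ) (hKU : 0 < KU) :
    Tendsto (slyThetaU q mL κ KU) atTop (𝓝 1) := by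
  have h1 : Tendsto (fun n => Real.exp (slyEB mL n)) atTop (𝓝 1) := by
    have := (Real.continuous_exp.tendsto 0).comp (tendsto_slyEB (mL := mL))
    rwa [Real.exp_zero] at this
  have h2 : Tendsto (fun n : ℕ => 1 + 2 / (Real.exp (2 * π ^ 2 / KU * n) - 1)) atTop (𝓝 1) := by
    have := (tendsto_two_div_exp_sub_one (c := 2 * π ^ 2 / KU) (by positivity)).const_add 1
    rwa [add_zero] at this
  have h3 := tendsto_slyRU (q := q) hκ
  have := (h1.mul h2).add h3
  rw [mul_one, add_zero] at this
  exact this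

/-- **The error factor tends to one.** [folklore] -/
theorem tendsto_slyErrU (hκ : 0 < κ) (hKU : 0 < KU) (hCU : 0 < CU) (hAU : 0 < AU) :
    Tendsto (slyErrU q mL κ c₀ KU CU AU) atTop (𝓝 1) := by
  have hA : Tendsto (fun n => Real.exp (slyEA mL n)) atTop (𝓝 1) := by
    have := (Real.continuous_exp.tendsto 0).comp (tendsto_slyEA (mL := mL))
    rwa [Real.exp_zero] at this
  have hT := tendsto_slyThetaU (q := q) (mL := mL) hκ hKU
  have hTq : Tendsto (fun n => slyThetaU q mL κ KU n ^ q) atTop (𝓝 1) := by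
    have := hT.pow q; rwa [one_pow] at this
  have hΞ : Tendsto (fun n : ℕ => Real.exp (120 * q * ((3 * ((q : ℝ) + 3) + 6) / mL ^ 5) * c₀ *
      (n : ℝ) ^ (-(3 / 10 : ℝ)))) atTop (𝓝 1) := by
    have h0 := (_root_.Literature.Computability.MetaComplexity.LevelledRefCNF.tendsto_rpow_neg_nat (y := 3 / 10) (by norm_num)).const_mul
      (120 * q * ((3 * ((q : ℝ) + 3) + 6) / mL ^ 5) * c₀)
    rw [mul_zero] at h0
    have := (Real.continuous_exp.tendsto 0).comp h0
    rwa [Real.exp_zero] at this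
  have hC : Tendsto (fun n : ℕ => 1 + 2 / (Real.exp (2 * π ^ 2 / CU * n) - 1)) atTop (𝓝 1) := by
    have := (tendsto_two_div_exp_sub_one (c := 2 * π ^ 2 / CU) (by positivity)).const_add 1
    rwa [add_zero] at this
  have hD : Tendsto (fun n : ℕ => 1 + 2 / (Real.exp (2 * π ^ 2 / AU * n) - 1)) atTop (𝓝 1) := by
    have := (tendsto_two_div_exp_sub_one (c := 2 * π ^ 2 / AU) (by positivity)).const_add 1
    rwa [add_zero] at this
  have := (((hA.mul hTq).mul hT).mul hΞ).mul (hC.mul hD)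
  simp only [mul_one] at this
  exact this

/-- `slyThetaU ≥ 0`. [folklore] -/
theorem slyThetaU_nonneg (hKU : 0 < KU) (n : ℕ) : 0 ≤ slyThetaU q mL κ KU n := by
  unfold slyThetaU slyRU
  have h1 : (0:ℝ) ≤ 1 + 2 / (Real.exp (2 * π ^ 2 / KU * n) - 1) := by
    rcases Nat.eq_zero_or_pos n with rfl | hn
    · simp
    · have hx : (0:ℝ) < 2 * π ^ 2 / KU * n := by positivity
      have : (0:ℝ) ≤ 2 / (Real.exp (2 * π ^ 2 / KU * n) - 1) :=
        div_nonneg (by norm_num) (by linarith [Real.add_one_lt_exp hx.ne'])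
      linarith
  positivity

/-- `slyErrU ≥ 0`. [folklore] -/
theorem slyErrU_nonneg (hKU : 0 < KU) (hCU : 0 < CU) (hAU : 0 < AU) (n : ℕ) :
    0 ≤ slyErrU q mL κ c₀ KU CU AU n := by
  unfold slyErrU
  have hT := slyThetaU_nonneg (q := q) (mL := mL) (κ := κ) hKU n
  have hpos : ∀ K : ℝ, 0 < K → (0:ℝ) ≤ 1 + 2 / (Real.exp (2 * π ^ 2 / K * n) - 1) := by
    intro K hK
    rcases Nat.eq_zero_or_pos n with rfl | hn
    · simp
    · have hx : (0:ℝ) < 2 * π ^ 2 / K * n := by positivity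
      have : (0:ℝ) ≤ 2 / (Real.exp (2 * π ^ 2 / K * n) - 1) :=
        div_nonneg (by norm_num) (by linarith [Real.add_one_lt_exp hx.ne'])
      linarith
  have h2 := hpos CU hCU
  have h3 := hpos AU hAU
  positivity

/-- **The far part tends to zero.** [folklore] -/
theorem tendsto_slyFarU (hκ : 0 < κ) (hc₀ : 0 < c₀) : Tendsto (slyFarU q κ c₀) atTop (𝓝 0) := by
  set c := κ * c₀ ^ 2 / 128 with hc
  have hc0 : 0 < c := by positivity
  -- squeeze between `0` and `C n^{K} e^{-(c/2) n^{1/5}}`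
  set K : ℝ := 2 + q + 1 + 5 * q / 2 + 7 / 2 with hK
  set C : ℝ := 2 ^ 2 * 3 ^ q * 2 * (2 : ℝ) ^ (5 * (q : ℝ) / 2) * Real.exp (10 * q + 14) with hC
  have hup := (tendsto_natCast_rpow_mul_exp_neg (k := K) (c := c / 2) (by positivity)
    (show (0:ℝ) < 1 / 5 by norm_num)).const_mul C
  rw [mul_zero] at hup
  have hslack := eventually_boundary_slack_le (b := 14) (c := c / 2) (by norm_num) (by positivity)
  refine tendsto_of_tendsto_of_tendsto_of_le_of_le' tendsto_const_nhds hup ?_ ?_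
  · filter_upwards with n
    unfold slyFarU; positivity
  · filter_upwards [eventually_ge_atTop 1, hslack] with n hn hsl
    have hnR : (1 : ℝ) ≤ n := by exact_mod_cast hn
    have hn0 : (0 : ℝ) < n := by linarith
    unfold slyFarU
    -- the exponent
    have hw2 : (n : ℝ) * (κ / 2 * (c₀ * (n : ℝ) ^ (-(2 / 5 : ℝ)) / 8) ^ 2) = c * (n : ℝ) ^ (1 / 5 : ℝ) := by
      rw [hc]
      have : (n : ℝ) * ((n : ℝ) ^ (-(2 / 5 : ℝ))) ^ 2 = (n : ℝ) ^ (1 / 5 : ℝ) := by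
        rw [← Real.rpow_natCast, ← Real.rpow_mul hn0.le]
        conv_lhs => rw [show (n : ℝ) = (n : ℝ) ^ (1 : ℝ) by rw [Real.rpow_one]]
        rw [← Real.rpow_mul hn0.le, ← Real.rpow_add hn0]; norm_num
      calc (n : ℝ) * (κ / 2 * (c₀ * (n : ℝ) ^ (-(2 / 5 : ℝ)) / 8) ^ 2)
          = κ * c₀ ^ 2 / 128 * ((n : ℝ) * ((n : ℝ) ^ (-(2 / 5 : ℝ))) ^ 2) := by ring
        _ = _ := by rw [this]
    rw [hw2]
    have hexp : Real.exp (5 * q * (Real.log (2 * n) / 2 + 2) + 7 * (Real.log n / 2 + 2) -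
        (c * (n : ℝ) ^ (1 / 5 : ℝ) - 14 * (n : ℝ) ^ (1 / 10 : ℝ) * (1 + Real.log (2 * n)))) ≤
        (2 : ℝ) ^ (5 * (q : ℝ) / 2) * Real.exp (10 * q + 14) * ((n : ℝ) ^ (5 * (q : ℝ) / 2 + 7 / 2) *
          Real.exp (-(c / 2) * (n : ℝ) ^ (1 / 5 : ℝ))) := by
      set sl := 14 * (n : ℝ) ^ (1 / 10 : ℝ) * (1 + Real.log (2 * n)) with hsl_def
      set t := (n : ℝ) ^ (1 / 5 : ℝ) with ht
      have a1 : Real.exp (5 * q * (Real.log (2 * n) / 2 + 2) + 7 * (Real.log n / 2 + 2) - (c * t - sl)) =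
          Real.exp (Real.log (2 * n) * (5 * (q : ℝ) / 2)) * Real.exp (Real.log n * (7 / 2)) *
            Real.exp (10 * q + 14) * Real.exp (sl - c * t) := by
        simp only [← Real.exp_add]
        congr 1; ring
      rw [← Real.rpow_def_of_pos (by positivity : (0:ℝ) < 2 * n), ← Real.rpow_def_of_pos hn0,
        Real.mul_rpow (by norm_num) hn0.le] at a1
      rw [a1]
      have hle : Real.exp (sl - c * t) ≤ Real.exp (-(c / 2) * t) := by
        rw [Real.exp_le_exp]; linarith
      have e2 : (n : ℝ) ^ (5 * (q : ℝ) / 2 + 7 / 2) = (n : ℝ) ^ (5 * (q : ℝ) / 2) * (n : ℝ) ^ (7 / 2 : ℝ) :=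
        Real.rpow_add hn0 _ _
      rw [e2]
      have h0 : 0 ≤ (2 : ℝ) ^ (5 * (q : ℝ) / 2) * (n : ℝ) ^ (5 * (q : ℝ) / 2) * (n : ℝ) ^ (7 / 2 : ℝ) *
          Real.exp (10 * q + 14) := by positivity
      calc (2 : ℝ) ^ (5 * (q : ℝ) / 2) * (n : ℝ) ^ (5 * (q : ℝ) / 2) * (n : ℝ) ^ (7 / 2 : ℝ) *
            Real.exp (10 * q + 14) * Real.exp (sl - c * t)
          ≤ ((2 : ℝ) ^ (5 * (q : ℝ) / 2) * (n : ℝ) ^ (5 * (q : ℝ) / 2) * (n : ℝ) ^ (7 / 2 : ℝ) *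
            Real.exp (10 * q + 14)) * Real.exp (-(c / 2) * t) := mul_le_mul_of_nonneg_left hle h0
        _ = _ := by ring
    -- the polynomial prefactor
    have hpoly : ((n : ℝ) + 1) ^ 2 * ((2 * (n : ℝ) + 1) ^ q * ((n : ℝ) + 1)) ≤
        2 ^ 2 * 3 ^ q * 2 * (n : ℝ) ^ ((2 : ℝ) + q + 1) := by
      have h1 : (n : ℝ) + 1 ≤ 2 * n := by linarith
      have h2 : 2 * (n : ℝ) + 1 ≤ 3 * n := by linarith
      have e : (n : ℝ) ^ ((2 : ℝ) + q + 1) = (n : ℝ) ^ 2 * (n : ℝ) ^ q * n := by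
        rw [Real.rpow_add hn0, Real.rpow_add hn0, Real.rpow_one, Real.rpow_natCast,
          show (2 : ℝ) = ((2 : ℕ) : ℝ) by norm_num, Real.rpow_natCast]
      rw [e]
      calc ((n : ℝ) + 1) ^ 2 * ((2 * (n : ℝ) + 1) ^ q * ((n : ℝ) + 1))
          ≤ (2 * (n : ℝ)) ^ 2 * ((3 * (n : ℝ)) ^ q * (2 * n)) := by
            apply mul_le_mul (pow_le_pow_left₀ (by positivity) h1 2)
              (mul_le_mul (pow_le_pow_left₀ (by positivity) h2 q) h1 (by positivity) (by positivity))
              (by positivity) (by positivity)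
        _ = 2 ^ 2 * 3 ^ q * 2 * ((n : ℝ) ^ 2 * (n : ℝ) ^ q * n) := by rw [mul_pow, mul_pow]; ring
    have hK' : (n : ℝ) ^ ((2 : ℝ) + q + 1) * (n : ℝ) ^ (5 * (q : ℝ) / 2 + 7 / 2) = (n : ℝ) ^ K := by
      rw [← Real.rpow_add hn0, hK]; congr 1; ring
    calc ((n : ℝ) + 1) ^ 2 * ((2 * (n : ℝ) + 1) ^ q * ((n : ℝ) + 1) *
          Real.exp (5 * q * (Real.log (2 * n) / 2 + 2) + 7 * (Real.log n / 2 + 2) -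
            (c * (n : ℝ) ^ (1 / 5 : ℝ) - 14 * (n : ℝ) ^ (1 / 10 : ℝ) * (1 + Real.log (2 * n)))))
        = (((n : ℝ) + 1) ^ 2 * ((2 * (n : ℝ) + 1) ^ q * ((n : ℝ) + 1))) *
          Real.exp (5 * q * (Real.log (2 * n) / 2 + 2) + 7 * (Real.log n / 2 + 2) -
            (c * (n : ℝ) ^ (1 / 5 : ℝ) - 14 * (n : ℝ) ^ (1 / 10 : ℝ) * (1 + Real.log (2 * n)))) := by ring
      _ ≤ (2 ^ 2 * 3 ^ q * 2 * (n : ℝ) ^ ((2 : ℝ) + q + 1)) *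
          ((2 : ℝ) ^ (5 * (q : ℝ) / 2) * Real.exp (10 * q + 14) * ((n : ℝ) ^ (5 * (q : ℝ) / 2 + 7 / 2) *
          Real.exp (-(c / 2) * (n : ℝ) ^ (1 / 5 : ℝ)))) :=
          mul_le_mul hpoly hexp (Real.exp_pos _).le (by positivity)
      _ = C * ((n : ℝ) ^ K * Real.exp (-(c / 2) * (n : ℝ) ^ (1 / 5 : ℝ))) := by
          rw [hC, ← hK']; ring

end Majorants

section Comparison

variable {q : ℕ} {mL κ c₀ KU : ℝ}

/-- `x ↦ 2/(eˣ - 1)` is antitone on `x > 0`. [folklore] -/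
theorem two_div_exp_sub_one_antitone {x y : ℝ} (hx : 0 < x) (hxy : x ≤ y) :
    2 / (Real.exp y - 1) ≤ 2 / (Real.exp x - 1) := by
  have h1 : 0 < Real.exp x - 1 := by linarith [Real.add_one_lt_exp hx.ne']
  apply div_le_div_of_nonneg_left (by norm_num) h1
  linarith [Real.exp_le_exp.mpr hxy]

/-- Powers of `w = n^{-2/5}`: `n w³ = n^{-1/5}`, `n w² = n^{1/5}`, `w n^{1/10} = n^{-3/10}`. [folklore] -/
theorem slyW_powers {n : ℕ} (hn : 1 ≤ n) :
    (n : ℝ) * ((n : ℝ) ^ (-(2 / 5 : ℝ))) ^ 3 = (n : ℝ) ^ (-(1 / 5 : ℝ)) ∧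
    (n : ℝ) * ((n : ℝ) ^ (-(2 / 5 : ℝ))) ^ 2 = (n : ℝ) ^ (1 / 5 : ℝ) ∧
    (n : ℝ) ^ (-(2 / 5 : ℝ)) * (n : ℝ) ^ (1 / 10 : ℝ) = (n : ℝ) ^ (-(3 / 10 : ℝ)) ∧
    (n : ℝ) ^ (-(2 / 5 : ℝ)) ≤ 1 ∧ 0 < (n : ℝ) ^ (-(2 / 5 : ℝ)) := by
  have hnR : (1 : ℝ) ≤ n := by exact_mod_cast hn
  have hn0 : (0 : ℝ) < n := by linarith
  have e1 : ∀ r : ℝ, (n : ℝ) * (n : ℝ) ^ r = (n : ℝ) ^ (1 + r) := fun r => by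
    rw [Real.rpow_add hn0, Real.rpow_one]
  refine ⟨?_, ?_, ?_, ?_, ?_⟩
  · rw [← Real.rpow_natCast, ← Real.rpow_mul hn0.le, e1]; norm_num
  · rw [← Real.rpow_natCast, ← Real.rpow_mul hn0.le, e1]; norm_num
  · rw [← Real.rpow_add hn0]; norm_num
  · exact Real.rpow_le_one_of_one_le_of_nonpos hnR (by norm_num)
  · positivity

/-- The overlap-factor error is dominated by `e^{E_A}`. [folklore] -/
theorem slyTA_le {n μ : ℕ} {m : ℝ} (hn : 1 ≤ n) (hmL : 0 < mL) (hm : mL ≤ m) (hc₀ : 0 < c₀)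
    (hc₀1 : c₀ ≤ 1) (hμ : (n : ℝ) * mL ^ 2 / 4 ≤ μ) :
    Real.exp (48 * n * (c₀ * (n : ℝ) ^ (-(2 / 5 : ℝ))) ^ 3 / m ^ 4 +
        8 * (c₀ * (n : ℝ) ^ (-(2 / 5 : ℝ))) / (m ^ 2 / 2) / 2 + 2 / (μ : ℝ)) ≤
      Real.exp (slyEA mL n) := by
  obtain ⟨p3, -, -, w1, w0⟩ := slyW_powers hn
  set w := (n : ℝ) ^ (-(2 / 5 : ℝ)) with hw
  have hnR : (1 : ℝ) ≤ n := by exact_mod_cast hn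
  have hn0 : (0 : ℝ) < n := by linarith
  have hm0 : 0 < m := lt_of_lt_of_le hmL hm
  rw [Real.exp_le_exp]
  unfold slyEA
  rw [← hw]
  have hμ0 : (0 : ℝ) < μ := lt_of_lt_of_le (by positivity) hμ
  -- term by term
  have t1 : 48 * n * (c₀ * w) ^ 3 / m ^ 4 ≤ 48 * (n : ℝ) ^ (-(1 / 5 : ℝ)) / mL ^ 4 := by
    rw [← p3]
    have h1 : (c₀ * w) ^ 3 ≤ w ^ 3 := by
      apply pow_le_pow_left₀ (by positivity); nlinarith
    have h2 : 1 / m ^ 4 ≤ 1 / mL ^ 4 :=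
      div_le_div_of_nonneg_left (by norm_num) (by positivity) (pow_le_pow_left₀ hmL.le hm 4)
    calc 48 * n * (c₀ * w) ^ 3 / m ^ 4 = 48 * n * (c₀ * w) ^ 3 * (1 / m ^ 4) := by ring
      _ ≤ 48 * n * w ^ 3 * (1 / mL ^ 4) :=
          mul_le_mul (mul_le_mul_of_nonneg_left h1 (by positivity)) h2 (by positivity) (by positivity)
      _ = 48 * (n * w ^ 3) / mL ^ 4 := by ring
  have t2 : 8 * (c₀ * w) / (m ^ 2 / 2) / 2 ≤ 8 * w / mL ^ 2 := by
    rw [show 8 * (c₀ * w) / (m ^ 2 / 2) / 2 = 8 * (c₀ * w) * (1 / m ^ 2) by ring]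
    have h1 : c₀ * w ≤ w := by nlinarith
    have h2 : 1 / m ^ 2 ≤ 1 / mL ^ 2 :=
      div_le_div_of_nonneg_left (by norm_num) (by positivity) (pow_le_pow_left₀ hmL.le hm 2)
    calc 8 * (c₀ * w) * (1 / m ^ 2) ≤ 8 * w * (1 / mL ^ 2) :=
          mul_le_mul (by linarith) h2 (by positivity) (by positivity)
      _ = 8 * w / mL ^ 2 := by ring
  have t3 : 2 / (μ : ℝ) ≤ 8 / (mL ^ 2 * n) := by
    rw [div_le_div_iff₀ hμ0 (by positivity)]; nlinarith
  have e8 : 8 * (n : ℝ) ^ (-(2 / 5 : ℝ)) / mL ^ 2 = 8 * w / mL ^ 2 := by rw [hw]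
  linarith

/-- One colour's factor `Θ` is dominated by `Θ_U`. [folklore] -/
theorem slyTheta_le_U {n Nc μ : ℕ} {m k3 KB : ℝ} (hn : 1 ≤ n) (hNc : n ≤ Nc) (hNc2 : Nc ≤ 2 * n)
    (hmL : 0 < mL) (hm : mL ≤ m) (hκ : 0 < κ) (hk3 : 0 < k3) (hKU : k3 ≤ KU) (hKB : 1 ≤ KB)
    (hμ : (n : ℝ) * mL ^ 2 / 4 ≤ μ) :
    Real.exp (180 * Nc * (2 * (n : ℝ) ^ (-(2 / 5 : ℝ))) ^ 3 / m ^ 4 +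
          19 * (2 * (n : ℝ) ^ (-(2 / 5 : ℝ))) / (2 * (m ^ 2 / 2)) + 11 / (6 * (μ : ℝ))) *
        (1 + 2 / (Real.exp (π ^ 2 / (k3 / (2 * Nc))) - 1)) +
      ((Nc : ℝ) + 1) * Real.exp (-(Nc * κ * ((n : ℝ) ^ (-(2 / 5 : ℝ))) ^ 2 / (2 * (q + 1 : ℕ))) +
        5 * (Real.log Nc / 2 + 2)) / KB ≤
      slyThetaU q mL κ KU n := by
  obtain ⟨p3, p2, -, w1, w0⟩ := slyW_powers hn
  set w := (n : ℝ) ^ (-(2 / 5 : ℝ)) with hw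
  have hnR : (1 : ℝ) ≤ n := by exact_mod_cast hn
  have hn0 : (0 : ℝ) < n := by linarith
  have hNcR : (n : ℝ) ≤ Nc := by exact_mod_cast hNc
  have hNc2R : (Nc : ℝ) ≤ 2 * n := by exact_mod_cast hNc2
  have hNc0 : (0 : ℝ) < Nc := by linarith
  have hm0 : 0 < m := lt_of_lt_of_le hmL hm
  have hμ0 : (0 : ℝ) < μ := lt_of_lt_of_le (by positivity) hμ
  have hKU0 : 0 < KU := lt_of_lt_of_le hk3 hKU
  unfold slyThetaU slyRU
  apply add_le_add
  · -- the main term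
    apply mul_le_mul _ _ (le_trans zero_le_one (one_le_thetaFactor (by positivity))) (by positivity)
    · rw [Real.exp_le_exp]
      unfold slyEB
      rw [← hw]
      have t1 : 180 * Nc * (2 * w) ^ 3 / m ^ 4 ≤ 2880 * (n : ℝ) ^ (-(1 / 5 : ℝ)) / mL ^ 4 := by
        rw [← p3]
        have h2 : 1 / m ^ 4 ≤ 1 / mL ^ 4 :=
          div_le_div_of_nonneg_left (by norm_num) (by positivity) (pow_le_pow_left₀ hmL.le hm 4)
        have hw3 : 0 ≤ w ^ 3 := by positivity
        calc 180 * Nc * (2 * w) ^ 3 / m ^ 4 = 1440 * Nc * w ^ 3 * (1 / m ^ 4) := by ring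
          _ ≤ 1440 * (2 * n) * w ^ 3 * (1 / mL ^ 4) := by
              apply mul_le_mul _ h2 (by positivity) (by positivity)
              exact mul_le_mul_of_nonneg_right (by linarith) hw3
          _ = 2880 * (n * w ^ 3) / mL ^ 4 := by ring
      have t2 : 19 * (2 * w) / (2 * (m ^ 2 / 2)) ≤ 38 * w / mL ^ 2 := by
        rw [show 19 * (2 * w) / (2 * (m ^ 2 / 2)) = 38 * w * (1 / m ^ 2) by ring]
        have h2 : 1 / m ^ 2 ≤ 1 / mL ^ 2 :=
          div_le_div_of_nonneg_left (by norm_num) (by positivity) (pow_le_pow_left₀ hmL.le hm 2)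
        calc 38 * w * (1 / m ^ 2) ≤ 38 * w * (1 / mL ^ 2) := mul_le_mul_of_nonneg_left h2 (by positivity)
          _ = 38 * w / mL ^ 2 := by ring
      have t3 : 11 / (6 * (μ : ℝ)) ≤ 8 / (mL ^ 2 * n) := by
        rw [div_le_div_iff₀ (by positivity) (by positivity)]; nlinarith
      have e38 : 38 * (n : ℝ) ^ (-(2 / 5 : ℝ)) / mL ^ 2 = 38 * w / mL ^ 2 := by rw [hw]
      linarith
    · -- `τ₃`
      apply add_le_add le_rfl
      apply two_div_exp_sub_one_antitone (by positivity)
      rw [div_div_eq_mul_div]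
      rw [show 2 * π ^ 2 / KU * (n : ℝ) = (2 * π ^ 2 * n) / KU by ring,
        show π ^ 2 * (2 * (Nc : ℝ)) / k3 = (2 * π ^ 2 * Nc) / k3 by ring]
      have hπ2 : 0 < 2 * π ^ 2 := by positivity
      calc (2 * π ^ 2 * n) / KU ≤ (2 * π ^ 2 * n) / k3 := div_le_div_of_nonneg_left (by positivity) hk3 hKU
        _ ≤ (2 * π ^ 2 * Nc) / k3 :=
            div_le_div_of_nonneg_right (mul_le_mul_of_nonneg_left hNcR hπ2.le) hk3.le
  · -- the remainder
    rw [div_le_iff₀ (by linarith)]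
    have e1 : -(Nc * κ * w ^ 2 / (2 * (q + 1 : ℕ))) ≤ -(κ / (2 * ((q : ℝ) + 1))) * (n : ℝ) ^ (1 / 5 : ℝ) := by
      rw [← p2]; push_cast
      have : (n : ℝ) * κ * w ^ 2 ≤ Nc * κ * w ^ 2 := by
        apply mul_le_mul_of_nonneg_right (mul_le_mul_of_nonneg_right hNcR hκ.le) (by positivity)
      have hq : (0 : ℝ) < 2 * ((q : ℝ) + 1) := by positivity
      rw [show -(κ / (2 * ((q : ℝ) + 1))) * (n * w ^ 2) = -((n * κ * w ^ 2) / (2 * ((q : ℝ) + 1))) by ring]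
      rw [neg_le_neg_iff, div_le_div_iff_of_pos_right hq]
      exact this
    have e2 : Real.log Nc ≤ Real.log (2 * n) := Real.log_le_log hNc0 hNc2R
    have h3 : Real.exp (-(Nc * κ * w ^ 2 / (2 * (q + 1 : ℕ))) + 5 * (Real.log Nc / 2 + 2)) ≤
        Real.exp (-(κ / (2 * ((q : ℝ) + 1))) * (n : ℝ) ^ (1 / 5 : ℝ) + 5 * (Real.log (2 * n) / 2 + 2)) := by
      rw [Real.exp_le_exp]; linarith
    have h4 : (Nc : ℝ) + 1 ≤ 2 * n + 1 := by linarith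
    calc ((Nc : ℝ) + 1) * Real.exp (-(Nc * κ * w ^ 2 / (2 * (q + 1 : ℕ))) + 5 * (Real.log Nc / 2 + 2))
        ≤ (2 * (n : ℝ) + 1) * Real.exp (-(κ / (2 * ((q : ℝ) + 1))) * (n : ℝ) ^ (1 / 5 : ℝ) +
            5 * (Real.log (2 * n) / 2 + 2)) := mul_le_mul h4 h3 (Real.exp_pos _).le (by positivity)
      _ = (2 * (n : ℝ) + 1) * Real.exp (-(κ / (2 * ((q : ℝ) + 1))) * (n : ℝ) ^ (1 / 5 : ℝ) +
            5 * (Real.log (2 * n) / 2 + 2)) * 1 := (mul_one _).symm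
      _ ≤ _ := mul_le_mul_of_nonneg_left hKB (by positivity)

end Comparison

section Assembly

variable {q : ℕ} {mL κ c₀ KU CU AU : ℝ}

/-- The boundary-slack factor is dominated. [folklore] -/
theorem slyXi_le {n mm : ℕ} {m' w : ℝ} (hn : 1 ≤ n) (hw : w = (n : ℝ) ^ (-(2 / 5 : ℝ)))
    (hmL : 0 < mL) (hm' : mL ≤ m') (hc₀ : 0 < c₀) (hmm : (mm : ℝ) ≤ (n : ℝ) ^ (1 / 10 : ℝ)) :
    Real.exp (120 * q * (3 * (((q + 1 : ℕ) : ℝ) + 2) / m' ^ 5 + 6 / m' ^ 5) * c₀ * w * mm) ≤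
      Real.exp (120 * q * ((3 * ((q : ℝ) + 3) + 6) / mL ^ 5) * c₀ * (n : ℝ) ^ (-(3 / 10 : ℝ))) := by
  obtain ⟨-, -, p4, w1, w0⟩ := slyW_powers hn
  rw [← hw] at p4 w1 w0
  rw [Real.exp_le_exp, ← p4]
  have hm0 : 0 < m' := lt_of_lt_of_le hmL hm'
  have hK : 3 * (((q + 1 : ℕ) : ℝ) + 2) / m' ^ 5 + 6 / m' ^ 5 ≤ (3 * ((q : ℝ) + 3) + 6) / mL ^ 5 := by
    push_cast
    rw [show 3 * ((q : ℝ) + 1 + 2) / m' ^ 5 + 6 / m' ^ 5 = (3 * ((q : ℝ) + 3) + 6) * (1 / m' ^ 5) by ring,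
      show (3 * ((q : ℝ) + 3) + 6) / mL ^ 5 = (3 * ((q : ℝ) + 3) + 6) * (1 / mL ^ 5) by ring]
    apply mul_le_mul_of_nonneg_left _ (by positivity)
    exact div_le_div_of_nonneg_left (by norm_num) (by positivity) (pow_le_pow_left₀ hmL.le hm' 5)
  have hK0 : 0 ≤ 3 * (((q + 1 : ℕ) : ℝ) + 2) / m' ^ 5 + 6 / m' ^ 5 := by positivity
  have hmm0 : (0 : ℝ) ≤ mm := Nat.cast_nonneg mm
  have h1 : w * mm ≤ w * (n : ℝ) ^ (1 / 10 : ℝ) := mul_le_mul_of_nonneg_left hmm w0.le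
  calc 120 * q * (3 * (((q + 1 : ℕ) : ℝ) + 2) / m' ^ 5 + 6 / m' ^ 5) * c₀ * w * mm
      = 120 * q * c₀ * ((3 * (((q + 1 : ℕ) : ℝ) + 2) / m' ^ 5 + 6 / m' ^ 5) * (w * mm)) := by ring
    _ ≤ 120 * q * c₀ * ((3 * ((q : ℝ) + 3) + 6) / mL ^ 5 * (w * (n : ℝ) ^ (1 / 10 : ℝ))) := by
        apply mul_le_mul_of_nonneg_left _ (by positivity)
        exact mul_le_mul hK h1 (by positivity) (le_trans hK0 hK)
    _ = _ := by ring

/-- The two Gaussian-sum factors are dominated. [folklore] -/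
theorem slyTauCD_le {n : ℕ} {At Bt Ct : ℝ} (hn : 1 ≤ n) (hCt : 0 < Ct) (hDt : 0 < At * Ct - Bt ^ 2)
    (hCU : Ct ≤ CU) (hAU : At ≤ AU) :
    (1 + 2 / (Real.exp (π ^ 2 / (Ct / (2 * n))) - 1)) * (1 + 2 / (Real.exp (π ^ 2 / ((At * Ct - Bt ^ 2) / (2 * n * Ct))) - 1)) ≤
      (1 + 2 / (Real.exp (2 * π ^ 2 / CU * n) - 1)) * (1 + 2 / (Real.exp (2 * π ^ 2 / AU * n) - 1)) := by
  have hnR : (1 : ℝ) ≤ n := by exact_mod_cast hn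
  have hn0 : (0 : ℝ) < n := by linarith
  have hAt : 0 < At := by
    by_contra h
    push Not at h
    nlinarith [sq_nonneg Bt, mul_nonpos_of_nonpos_of_nonneg h hCt.le]
  have hCU0 : 0 < CU := lt_of_lt_of_le hCt hCU
  have hAU0 : 0 < AU := lt_of_lt_of_le hAt hAU
  have hπ2 : 0 < 2 * π ^ 2 := by positivity
  have hpos : ∀ x : ℝ, 0 < x → (0:ℝ) ≤ 2 / (Real.exp x - 1) := fun x hx =>
    div_nonneg (by norm_num) (by linarith [Real.add_one_lt_exp hx.ne'])
  have h1 : (0:ℝ) ≤ 1 + 2 / (Real.exp (π ^ 2 / ((At * Ct - Bt ^ 2) / (2 * n * Ct))) - 1) := by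
    linarith [hpos (π ^ 2 / ((At * Ct - Bt ^ 2) / (2 * n * Ct))) (by positivity)]
  have h2 : (0:ℝ) ≤ 1 + 2 / (Real.exp (2 * π ^ 2 / CU * n) - 1) := by
    linarith [hpos (2 * π ^ 2 / CU * n) (by positivity)]
  apply mul_le_mul _ _ h1 h2
  · apply add_le_add le_rfl
    apply two_div_exp_sub_one_antitone (by positivity)
    rw [div_div_eq_mul_div, show 2 * π ^ 2 / CU * (n : ℝ) = (2 * π ^ 2 * n) / CU by ring,
      show π ^ 2 * (2 * (n : ℝ)) / Ct = (2 * π ^ 2 * n) / Ct by ring]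
    exact div_le_div_of_nonneg_left (by positivity) hCt hCU
  · apply add_le_add le_rfl
    apply two_div_exp_sub_one_antitone (by positivity)
    rw [div_div_eq_mul_div, show 2 * π ^ 2 / AU * (n : ℝ) = (2 * π ^ 2 * n) / AU by ring]
    rw [div_le_div_iff₀ hAU0 hDt]
    have : At * Ct - Bt ^ 2 ≤ AU * Ct := by nlinarith [sq_nonneg Bt, mul_le_mul_of_nonneg_right hAU hCt.le]
    calc 2 * π ^ 2 * n * (At * Ct - Bt ^ 2) ≤ 2 * π ^ 2 * n * (AU * Ct) :=
          mul_le_mul_of_nonneg_left this (by positivity)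
      _ = π ^ 2 * (2 * n * Ct) * AU := by ring

/-- The far part is dominated. [folklore] -/
theorem slyFar_le_U {n N mm : ℕ} {w : ℝ} (hn : 1 ≤ n) (hw : w = (n : ℝ) ^ (-(2 / 5 : ℝ)))
    (hNn : N = n + mm) (hmmn : mm ≤ n) (hmm : (mm : ℝ) ≤ (n : ℝ) ^ (1 / 10 : ℝ)) :
    ((n : ℝ) + 1) ^ 2 * (((N : ℝ) + 1) ^ q * ((n : ℝ) + 1) *
        Real.exp (5 * q * (Real.log N / 2 + 2) + 7 * (Real.log n / 2 + 2) -
          (n * (κ / 2 * (c₀ * w / 8) ^ 2) - 14 * mm * (1 + Real.log N)))) ≤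
      slyFarU q κ c₀ n := by
  have hnR : (1 : ℝ) ≤ n := by exact_mod_cast hn
  have hn0 : (0 : ℝ) < n := by linarith
  have hN1 : 1 ≤ N := by omega
  have hNR : (1 : ℝ) ≤ N := by exact_mod_cast hN1
  have hN2 : (N : ℝ) ≤ 2 * n := by
    have : N ≤ 2 * n := by omega
    exact_mod_cast this
  have hmm0 : (0 : ℝ) ≤ mm := Nat.cast_nonneg mm
  unfold slyFarU
  rw [← hw]
  apply mul_le_mul_of_nonneg_left _ (by positivity)
  apply mul_le_mul _ _ (Real.exp_pos _).le (by positivity)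
  · apply mul_le_mul_of_nonneg_right _ (by positivity)
    exact pow_le_pow_left₀ (by positivity) (by linarith) q
  · rw [Real.exp_le_exp]
    have hlog : Real.log N ≤ Real.log (2 * n) := Real.log_le_log (by linarith) hN2
    have hlogN : 0 ≤ Real.log N := Real.log_nonneg hNR
    have hL : 0 ≤ 1 + Real.log (2 * n) := by linarith
    have h1 : (14 : ℝ) * mm * (1 + Real.log N) ≤ 14 * (n : ℝ) ^ (1 / 10 : ℝ) * (1 + Real.log (2 * n)) := by
      apply mul_le_mul (mul_le_mul_of_nonneg_left hmm (by norm_num)) (by linarith) (by positivity)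
        (by positivity)
    have hq0 : (0 : ℝ) ≤ 5 * q := by positivity
    nlinarith [mul_le_mul_of_nonneg_left hlog hq0]

set_option maxHeartbeats 1600000 in
/-- **The explicit bound is dominated by `MainConst · Err_U + Far_U`.** [folklore] -/
theorem slyExplicitRHS_le {n N mm μ μ' : ℕ} {α β α' β' m m' w : ℝ} (hn : 1 ≤ n)
    (hw : w = (n : ℝ) ^ (-(2 / 5 : ℝ))) (hμμ : μ = μ') (hNn : N = n + mm) (hmmn : mm ≤ n)
    (hmm : (mm : ℝ) ≤ (n : ℝ) ^ (1 / 10 : ℝ))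
    (hα0 : 0 < α) (hβ0 : 0 < β) (hαβ : α + β < 1) (hα0' : 0 < α') (hβ0' : 0 < β') (hαβ' : α' + β' < 1)
    (hmL : 0 < mL) (hm : mL ≤ m) (hm' : mL ≤ m') (hκ : 0 < κ) (hc₀ : 0 < c₀) (hc₀1 : c₀ ≤ 1)
    (hμ : (n : ℝ) * mL ^ 2 / 4 ≤ μ) (hKU : slyK3 α β ≤ KU) (hKU' : slyK3 α' β' ≤ KU)
    (hCt : 0 < slySCgen q ((n : ℝ) / N) α β α' β')
    (hDt : 0 < slySAgen q ((n : ℝ) / N) α β α' β' * slySCgen q ((n : ℝ) / N) α β α' β' -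
      slySBgen q ((n : ℝ) / N) α β α' β' ^ 2)
    (hCU : slySCgen q ((n : ℝ) / N) α β α' β' ≤ CU) (hAU : slySAgen q ((n : ℝ) / N) α β α' β' ≤ AU) :

      (Real.exp (slyPrefA α β (α ^ 2) (β ^ 2) / 2) *
          (Real.exp (slyPrefB α' β' (α' ^ 2) (β' ^ 2) (α' * (1 - α' - β')) / 2) / Real.sqrt (slyK3 α' β')) ^ q *
          (Real.exp (slyPrefB α β (α ^ 2) (β ^ 2) (α * (1 - α - β)) / 2) / Real.sqrt (slyK3 α β)) /
          Real.sqrt (slySAgen q ((n : ℝ) / N) α β α' β' * slySCgen q ((n : ℝ) / N) α β α' β' -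
            slySBgen q ((n : ℝ) / N) α β α' β' ^ 2)) *
        (Real.exp (48 * n * (c₀ * w) ^ 3 / m ^ 4 + 8 * (c₀ * w) / (m ^ 2 / 2) / 2 + 2 / (μ : ℝ)) *
          (Real.exp (180 * N * (2 * w) ^ 3 / m' ^ 4 + 19 * (2 * w) / (2 * (m' ^ 2 / 2)) + 11 / (6 * (μ' : ℝ))) *
              (1 + 2 / (rexp (π ^ 2 / (slyK3 α' β' / (2 * N))) - 1)) +
            ((N : ℝ) + 1) * Real.exp (-(N * κ * w ^ 2 / (2 * (q + 1 : ℕ))) + 5 * (Real.log N / 2 + 2)) /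
              (Real.exp (slyPrefB α' β' (α' ^ 2) (β' ^ 2) (α' * (1 - α' - β')) / 2) / Real.sqrt (slyK3 α' β'))) ^ q *
          (Real.exp (180 * n * (2 * w) ^ 3 / m ^ 4 + 19 * (2 * w) / (2 * (m ^ 2 / 2)) + 11 / (6 * (μ : ℝ))) *
              (1 + 2 / (rexp (π ^ 2 / (slyK3 α β / (2 * n))) - 1)) +
            ((n : ℝ) + 1) * Real.exp (-(n * κ * w ^ 2 / (2 * (q + 1 : ℕ))) + 5 * (Real.log n / 2 + 2)) /
              (Real.exp (slyPrefB α β (α ^ 2) (β ^ 2) (α * (1 - α - β)) / 2) / Real.sqrt (slyK3 α β))) *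
          Real.exp (120 * q * (3 * (((q + 1 : ℕ) : ℝ) + 2) / m' ^ 5 + 6 / m' ^ 5) * c₀ * w * mm) *
          ((1 + 2 / (rexp (π ^ 2 / (slySCgen q ((n : ℝ) / N) α β α' β' / (2 * n))) - 1)) *
            (1 + 2 / (rexp (π ^ 2 / ((slySAgen q ((n : ℝ) / N) α β α' β' * slySCgen q ((n : ℝ) / N) α β α' β' -
              slySBgen q ((n : ℝ) / N) α β α' β' ^ 2) / (2 * n * slySCgen q ((n : ℝ) / N) α β α' β'))) - 1)))) +
      ((n : ℝ) + 1) ^ 2 * (((N : ℝ) + 1) ^ q * ((n : ℝ) + 1) *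
        Real.exp (5 * q * (Real.log N / 2 + 2) + 7 * (Real.log n / 2 + 2) -
          (n * (κ / 2 * (c₀ * w / 8) ^ 2) - 14 * mm * (1 + Real.log N)))) ≤
      slyMainConst q (α, β, α', β', (n : ℝ) / N) * slyErrU q mL κ c₀ KU CU AU n + slyFarU q κ c₀ n := by
  subst hw hμμ
  have hN1 : 1 ≤ N := by omega
  have hnN : n ≤ N := by omega
  have hN2 : N ≤ 2 * n := by omega
  have hκ3 := slyK3_pos hα0 hβ0 hαβ
  have hκ3' := slyK3_pos hα0' hβ0' hαβ'
  have hKB := one_le_slyKB hα0 hβ0 hαβ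
  have hKB' := one_le_slyKB hα0' hβ0' hαβ'
  -- the pieces
  have hTA := slyTA_le (mL := mL) (c₀ := c₀) (m := m) hn hmL hm hc₀ hc₀1 hμ
  have hΘ := slyTheta_le_U (q := q) (mL := mL) (κ := κ) (KU := KU) (Nc := n) (m := m) hn le_rfl (by omega)
    hmL hm hκ hκ3 hKU hKB hμ
  have hΘ' := slyTheta_le_U (q := q) (mL := mL) (κ := κ) (KU := KU) (Nc := N) (m := m') hn hnN hN2
    hmL hm' hκ hκ3' hKU' hKB' hμ
  have hΞ := slyXi_le (q := q) (c₀ := c₀) (mm := mm) (m' := m') hn rfl hmL hm' hc₀ hmm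
  have hτ := slyTauCD_le (CU := CU) (AU := AU) hn hCt hDt hCU hAU
  have hFar := slyFar_le_U (q := q) (κ := κ) (c₀ := c₀) hn rfl hNn hmmn hmm
  -- nonnegativity
  have h1τ : 1 ≤ 1 + 2 / (rexp (π ^ 2 / (slyK3 α β / (2 * n))) - 1) := one_le_thetaFactor (by positivity)
  have h1τ' : 1 ≤ 1 + 2 / (rexp (π ^ 2 / (slyK3 α' β' / (2 * N))) - 1) := one_le_thetaFactor (by positivity)
  have hKBpos : 0 < Real.exp (slyPrefB α β (α ^ 2) (β ^ 2) (α * (1 - α - β)) / 2) / Real.sqrt (slyK3 α β) :=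
    div_pos (Real.exp_pos _) (Real.sqrt_pos.mpr hκ3)
  have hKBpos' : 0 < Real.exp (slyPrefB α' β' (α' ^ 2) (β' ^ 2) (α' * (1 - α' - β')) / 2) / Real.sqrt (slyK3 α' β') :=
    div_pos (Real.exp_pos _) (Real.sqrt_pos.mpr hκ3')
  have hΘ0 : 0 ≤ Real.exp (180 * n * (2 * (n : ℝ) ^ (-(2 / 5 : ℝ))) ^ 3 / m ^ 4 +
        19 * (2 * (n : ℝ) ^ (-(2 / 5 : ℝ))) / (2 * (m ^ 2 / 2)) + 11 / (6 * (μ : ℝ))) *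
        (1 + 2 / (rexp (π ^ 2 / (slyK3 α β / (2 * n))) - 1)) +
      ((n : ℝ) + 1) * Real.exp (-(n * κ * ((n : ℝ) ^ (-(2 / 5 : ℝ))) ^ 2 / (2 * (q + 1 : ℕ))) + 5 * (Real.log n / 2 + 2)) /
        (Real.exp (slyPrefB α β (α ^ 2) (β ^ 2) (α * (1 - α - β)) / 2) / Real.sqrt (slyK3 α β)) := by positivity
  have hΘ0' : 0 ≤ Real.exp (180 * N * (2 * (n : ℝ) ^ (-(2 / 5 : ℝ))) ^ 3 / m' ^ 4 +
        19 * (2 * (n : ℝ) ^ (-(2 / 5 : ℝ))) / (2 * (m' ^ 2 / 2)) + 11 / (6 * (μ : ℝ))) *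
        (1 + 2 / (rexp (π ^ 2 / (slyK3 α' β' / (2 * N))) - 1)) +
      ((N : ℝ) + 1) * Real.exp (-(N * κ * ((n : ℝ) ^ (-(2 / 5 : ℝ))) ^ 2 / (2 * (q + 1 : ℕ))) + 5 * (Real.log N / 2 + 2)) /
        (Real.exp (slyPrefB α' β' (α' ^ 2) (β' ^ 2) (α' * (1 - α' - β')) / 2) / Real.sqrt (slyK3 α' β')) := by positivity
  have hU0 : 0 ≤ slyThetaU q mL κ KU n := le_trans hΘ0 hΘ
  have hτ0 : 0 ≤ (1 + 2 / (rexp (π ^ 2 / (slySCgen q ((n : ℝ) / N) α β α' β' / (2 * n))) - 1)) *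
      (1 + 2 / (rexp (π ^ 2 / ((slySAgen q ((n : ℝ) / N) α β α' β' * slySCgen q ((n : ℝ) / N) α β α' β' -
        slySBgen q ((n : ℝ) / N) α β α' β' ^ 2) / (2 * n * slySCgen q ((n : ℝ) / N) α β α' β'))) - 1)) :=
    mul_nonneg (le_trans zero_le_one (one_le_thetaFactor (by positivity)))
      (le_trans zero_le_one (one_le_thetaFactor (by positivity)))
  -- the error factor
  have hErr : Real.exp (48 * n * (c₀ * (n : ℝ) ^ (-(2 / 5 : ℝ))) ^ 3 / m ^ 4 +
        8 * (c₀ * (n : ℝ) ^ (-(2 / 5 : ℝ))) / (m ^ 2 / 2) / 2 + 2 / (μ : ℝ)) *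
      (Real.exp (180 * N * (2 * (n : ℝ) ^ (-(2 / 5 : ℝ))) ^ 3 / m' ^ 4 +
        19 * (2 * (n : ℝ) ^ (-(2 / 5 : ℝ))) / (2 * (m' ^ 2 / 2)) + 11 / (6 * (μ : ℝ))) *
        (1 + 2 / (rexp (π ^ 2 / (slyK3 α' β' / (2 * N))) - 1)) +
      ((N : ℝ) + 1) * Real.exp (-(N * κ * ((n : ℝ) ^ (-(2 / 5 : ℝ))) ^ 2 / (2 * (q + 1 : ℕ))) + 5 * (Real.log N / 2 + 2)) /
        (Real.exp (slyPrefB α' β' (α' ^ 2) (β' ^ 2) (α' * (1 - α' - β')) / 2) / Real.sqrt (slyK3 α' β'))) ^ q *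
      (Real.exp (180 * n * (2 * (n : ℝ) ^ (-(2 / 5 : ℝ))) ^ 3 / m ^ 4 +
        19 * (2 * (n : ℝ) ^ (-(2 / 5 : ℝ))) / (2 * (m ^ 2 / 2)) + 11 / (6 * (μ : ℝ))) *
        (1 + 2 / (rexp (π ^ 2 / (slyK3 α β / (2 * n))) - 1)) +
      ((n : ℝ) + 1) * Real.exp (-(n * κ * ((n : ℝ) ^ (-(2 / 5 : ℝ))) ^ 2 / (2 * (q + 1 : ℕ))) + 5 * (Real.log n / 2 + 2)) /
        (Real.exp (slyPrefB α β (α ^ 2) (β ^ 2) (α * (1 - α - β)) / 2) / Real.sqrt (slyK3 α β))) *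
      Real.exp (120 * q * (3 * (((q + 1 : ℕ) : ℝ) + 2) / m' ^ 5 + 6 / m' ^ 5) * c₀ * (n : ℝ) ^ (-(2 / 5 : ℝ)) * mm) *
      ((1 + 2 / (rexp (π ^ 2 / (slySCgen q ((n : ℝ) / N) α β α' β' / (2 * n))) - 1)) *
        (1 + 2 / (rexp (π ^ 2 / ((slySAgen q ((n : ℝ) / N) α β α' β' * slySCgen q ((n : ℝ) / N) α β α' β' -
          slySBgen q ((n : ℝ) / N) α β α' β' ^ 2) / (2 * n * slySCgen q ((n : ℝ) / N) α β α' β'))) - 1))) ≤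
      slyErrU q mL κ c₀ KU CU AU n := by
    unfold slyErrU
    have hP0 : 0 ≤ Real.exp (slyEA mL n) * slyThetaU q mL κ KU n ^ q :=
      mul_nonneg (Real.exp_pos _).le (pow_nonneg hU0 q)
    apply mul_le_mul _ hτ hτ0 (mul_nonneg (mul_nonneg hP0 hU0) (Real.exp_pos _).le)
    apply mul_le_mul _ hΞ (Real.exp_pos _).le (mul_nonneg hP0 hU0)
    apply mul_le_mul _ hΘ hΘ0 hP0
    exact mul_le_mul hTA (pow_le_pow_left₀ hΘ0' hΘ' q) (by positivity) (Real.exp_pos _).le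
  have hMC : Real.exp (slyPrefA α β (α ^ 2) (β ^ 2) / 2) *
      (Real.exp (slyPrefB α' β' (α' ^ 2) (β' ^ 2) (α' * (1 - α' - β')) / 2) / Real.sqrt (slyK3 α' β')) ^ q *
      (Real.exp (slyPrefB α β (α ^ 2) (β ^ 2) (α * (1 - α - β)) / 2) / Real.sqrt (slyK3 α β)) /
      Real.sqrt (slySAgen q ((n : ℝ) / N) α β α' β' * slySCgen q ((n : ℝ) / N) α β α' β' -
        slySBgen q ((n : ℝ) / N) α β α' β' ^ 2) = slyMainConst q (α, β, α', β', (n : ℝ) / N) := by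
    unfold slyMainConst slyKB slyDt; rfl
  have hMC0 : 0 ≤ slyMainConst q (α, β, α', β', (n : ℝ) / N) := by
    rw [← hMC]; positivity
  rw [hMC]
  exact add_le_add (mul_le_mul_of_nonneg_left hErr hMC0) hFar

end Assembly

section Final

/-- Cells in the box: if `|α - p⁺|, |β - p⁻| ≤ M/4` with `M = min(p⁺, p⁻, 1-p⁺-p⁻)` then all cells are at
least `M/2`. [folklore] -/
theorem slyBox {pp pm α β : ℝ} (hα : |α - pp| ≤ min (min pp pm) (1 - pp - pm) / 4)
    (hβ : |β - pm| ≤ min (min pp pm) (1 - pp - pm) / 4) :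
    min (min pp pm) (1 - pp - pm) / 2 ≤ α ∧ min (min pp pm) (1 - pp - pm) / 2 ≤ β ∧
      min (min pp pm) (1 - pp - pm) / 2 ≤ 1 - α - β := by
  set M := min (min pp pm) (1 - pp - pm) with hM
  have h1 : M ≤ pp := le_trans (min_le_left _ _) (min_le_left _ _)
  have h2 : M ≤ pm := le_trans (min_le_left _ _) (min_le_right _ _)
  have h3 : M ≤ 1 - pp - pm := min_le_right _ _
  rw [abs_le] at hα hβ
  refine ⟨by linarith, by linarith, by linarith⟩

set_option maxHeartbeats 6400000 in
/-- **The second moment of Sly's slice partition function** (the analytic core of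
[Sly2010, Theorem 3.10] via Lemma 3.5 and the Laplace analysis of
[MosselWeitzWormald2008, Theorem 6.11]): for every `ε > 0` there are a window `χ > 0` and `n₀`
such that for `n ≥ n₀`, `m' ≤ n^{1/10}` boundary vertices with any numbers `ep, em ≤ m'` of occupied
plus/minus ports, and all slice densities `(a/n, b/n)` within `χ` of the fixed point `(p⁺, p⁻)`,
`E[Z_{a,b}(η)²]/(E Z_{a,b}(η))² = slyRatioGen n (n+m') q a b ep em ≤ (1 + ε) τ(q+1, p⁺, p⁻)`.
[cite: Sly2010, Lemma 3.5 and proof of Theorem 3.10; MosselWeitzWormald2008, Theorem 6.11] -/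
theorem slyRatioGen_le_tau (q : ℕ) (hq : 2 ≤ q) {lam pp pm : ℝ}
    (hlam : hardCoreThreshold (q + 1) < lam) (hpm : 0 < pm) (hlt : pm < pp) (hsum : pp + pm < 1)
    (hEα : lam * (1 - pp - pm) ^ (q + 1) = pp * (1 - pp) ^ (q + 1 - 1))
    (hEβ : lam * (1 - pp - pm) ^ (q + 1) = pm * (1 - pm) ^ (q + 1 - 1))
    (hρ : (((q + 1 : ℕ) : ℝ) - 1) * pp * pm < (1 - pp) * (1 - pm)) :
    ∀ ε : ℝ, 0 < ε → ∃ χ : ℝ, 0 < χ ∧ ∃ n₀ : ℕ, ∀ n : ℕ, n₀ ≤ n →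
      ∀ mm : ℕ, (mm : ℝ) ≤ (n : ℝ) ^ (1 / 10 : ℝ) →
      ∀ a b ep em : ℕ, ep ≤ mm → em ≤ mm → |(a : ℝ) / n - pp| ≤ χ → |(b : ℝ) / n - pm| ≤ χ →
        slyRatioGen n (n + mm) q a b ep em ≤ (1 + ε) * slyTau (q + 1) pp pm := by
  intro ε hε
  have hpp : 0 < pp := lt_trans hpm hlt
  have hd1 : 1 ≤ q + 1 := by omega
  have hd3 : 3 ≤ q + 1 := by omega
  -- WLOG `ε ≤ 4`
  set ε' := min ε 4 with hε'
  have hε'0 : 0 < ε' := lt_min hε (by norm_num)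
  have hε'4 : ε' ≤ 4 := min_le_right _ _
  have hε'ε : ε' ≤ ε := min_le_left _ _
  -- the Hessian constant
  obtain ⟨χ₁, hχ₁, κ, hκ, HPD⟩ := slyQ_le_neg_near (q + 1) hd1 hpp hpm hsum hρ
  -- the cell constant
  set M := min (min pp pm) (1 - pp - pm) with hM
  have hM0 : 0 < M := lt_min (lt_min hpp hpm) (by linarith only [hsum])
  have hM1 : M ≤ 1 - pp - pm := min_le_right _ _
  set mL := M / 2 with hmL
  have hmL0 : 0 < mL := by positivity
  -- the cone radius and the gap
  set r₀ := min (mL ^ 2 / 6) (κ * mL ^ 4 / (648 * (4 + 7 * ((q + 1 : ℕ) : ℝ)))) with hr₀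
  have hr₀0 : 0 < r₀ := lt_min (by positivity) (by positivity)
  obtain ⟨χ₂, hχ₂, η, hη, HGAP⟩ := slyRate_gap_near_fixedPoint hd3 hlam hpm hlt hsum hEα hEβ hr₀0
  -- the planar constants at the fixed point
  have HPDp := (HPD pp pm (by simp [hχ₁]) (by simp [hχ₁])).2
  obtain ⟨hCp, hAp, hDp, -, -, -⟩ := slyS_bounds (d := q + 1) hpp hpm hsum rfl hκ HPDp
  set Cp := slySC (q + 1) pp pm with hCp_def
  set Ap := slySA (q + 1) pp pm with hAp_def
  set Dp := slySA (q + 1) pp pm * slySC (q + 1) pp pm - slySB (q + 1) pp pm ^ 2 with hDp_def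
  have hCp0 : 0 < Cp := by linarith only [hCp, hκ]
  have hDp0 : 0 < Dp := by
    have : 0 < 2 * κ * Cp := by positivity
    linarith only [this, hDp]
  -- `τ` and the main constant at the fixed point
  set τ := slyTau (q + 1) pp pm with hτ
  have hMCp := slyMainConst_fixedPoint (q := q) hpp hpm hsum hDp0
  have hKBp : 0 < slyKB pp pm := lt_of_lt_of_le zero_lt_one (one_le_slyKB hpp hpm hsum)
  have hτ0 : 0 < τ := by
    rw [hτ, ← hMCp]
    unfold slyMainConst
    dsimp only
    apply div_pos (mul_pos (mul_pos (Real.exp_pos _) (pow_pos hKBp q)) hKBp)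
    rw [slyDt_one_eq]; exact Real.sqrt_pos.mpr hDp0
  -- continuity at `z₀`
  have hcM := Metric.continuousAt_iff.mp (continuousAt_slyMainConst (q := q) hpp hpm hsum hDp0)
  have hcCA := continuousAt_slySCgen (q := q) (θ := 1) hpp hpm hsum hpp hpm hsum
  have hcC := Metric.continuousAt_iff.mp hcCA.1
  have hcA := Metric.continuousAt_iff.mp hcCA.2
  have hcD := Metric.continuousAt_iff.mp (continuousAt_slyDt (q := q) (θ := 1) hpp hpm hsum hpp hpm hsum)
  obtain ⟨δM, hδM, HM⟩ := hcM (τ * ε' / 4) (by positivity)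
  obtain ⟨δC, hδC, HC⟩ := hcC κ hκ
  obtain ⟨δA, hδA, HA⟩ := hcA κ hκ
  obtain ⟨δD, hδD, HD⟩ := hcD (Dp / 2) (by positivity)
  set δ := min (min δM δC) (min δA δD) with hδ
  have hδ0 : 0 < δ := lt_min (lt_min hδM hδC) (lt_min hδA hδD)
  -- the window
  have hχ₃ : 0 < (1 / 2 - pm) / 2 := by linarith only [hlt, hsum]
  set χ := min (min (M / 8) (χ₁ / 3)) (min (χ₂ / 3) (min ((1 / 2 - pm) / 2) (δ / 3))) with hχdef
  have hχ0 : 0 < χ := lt_min (lt_min (by positivity) (by positivity))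
    (lt_min (by positivity) (lt_min hχ₃ (by positivity)))
  have hχM : χ ≤ M / 8 := le_trans (min_le_left _ _) (min_le_left _ _)
  have hχ1 : χ ≤ χ₁ / 3 := le_trans (min_le_left _ _) (min_le_right _ _)
  have hχ2 : χ ≤ χ₂ / 3 := le_trans (min_le_right _ _) (min_le_left _ _)
  have hχ3 : χ ≤ (1 / 2 - pm) / 2 := le_trans (min_le_right _ _) (le_trans (min_le_right _ _) (min_le_left _ _))
  have hχδ : χ ≤ δ / 3 := le_trans (min_le_right _ _) (le_trans (min_le_right _ _) (min_le_right _ _))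
  refine ⟨χ, hχ0, ?_⟩
  -- the constants of the majorants
  set c₀ := min (1 / 2 : ℝ) (κ * mL ^ 5 / (96 * ((q : ℝ) + 3))) with hc₀
  have hq3 : (0 : ℝ) < (q : ℝ) + 3 := by positivity
  have hc₀0 : 0 < c₀ := lt_min (by norm_num) (by positivity)
  have hc₀h : c₀ ≤ 1 / 2 := min_le_left _ _
  have hc₀1 : c₀ ≤ 1 := by linarith only [hc₀h]
  have hc₀κ : c₀ ≤ κ * mL ^ 5 / (96 * ((q : ℝ) + 3)) := min_le_right _ _
  set KU := 2 / mL ^ 5 with hKU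
  have hKU0 : 0 < KU := by positivity
  set CU := Cp + κ with hCU
  set AU := Ap + κ with hAU
  have hCU0 : 0 < CU := by positivity
  have hAU0 : 0 < AU := by
    have : 0 < Ap := by linarith only [hAp, hκ]
    positivity
  set wmax := min (min (η / κ) (mL ^ 2 / 8)) (κ * mL ^ 4 / 384) with hwmax
  have hwmax0 : 0 < wmax := lt_min (lt_min (by positivity) (by positivity)) (by positivity)
  -- eventualities
  have E1 : ∀ᶠ n : ℕ in atTop, slyErrU q mL κ c₀ KU CU AU n < 1 + ε' / 4 :=
    (tendsto_slyErrU (q := q) (mL := mL) (c₀ := c₀) hκ hKU0 hCU0 hAU0).eventually_lt_const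
      (by linarith only [hε'0])
  have E2 : ∀ᶠ n : ℕ in atTop, slyFarU q κ c₀ n < τ * ε' / 4 :=
    (tendsto_slyFarU (q := q) hκ hc₀0).eventually_lt_const (by positivity)
  have E3 : ∀ᶠ n : ℕ in atTop, (n : ℝ) ^ (-(2 / 5 : ℝ)) < wmax :=
    (_root_.Literature.Computability.MetaComplexity.LevelledRefCNF.tendsto_rpow_neg_nat (y := 2 / 5) (by norm_num)).eventually_lt_const hwmax0
  have E4 : ∀ᶠ n : ℕ in atTop, (n : ℝ) ^ (-(9 / 10 : ℝ)) < min (χ / 2) ((1 - pp - pm) / 4) :=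
    (_root_.Literature.Computability.MetaComplexity.LevelledRefCNF.tendsto_rpow_neg_nat (y := 9 / 10) (by norm_num)).eventually_lt_const
      (lt_min (by positivity) (by linarith only [hsum]))
  have E5 : ∀ᶠ n : ℕ in atTop, 40 / c₀ ≤ (n : ℝ) ^ (1 / 2 : ℝ) :=
    (_root_.Literature.Probability.RandomGraphs.tendsto_natCast_rpow_atTop (c := 1 / 2) (by norm_num)).eventually_ge_atTop _
  have E6 : ∀ᶠ n : ℕ in atTop, 4 / mL ^ 2 ≤ (n : ℝ) :=
    tendsto_natCast_atTop_atTop.eventually_ge_atTop _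
  have E7 : ∀ᶠ n : ℕ in atTop, (n : ℝ) ^ (-(9 / 10 : ℝ)) < (1 / 2 - pm) / 2 :=
    (_root_.Literature.Computability.MetaComplexity.LevelledRefCNF.tendsto_rpow_neg_nat (y := 9 / 10) (by norm_num)).eventually_lt_const hχ₃
  obtain ⟨n₀, Hn₀⟩ := Filter.eventually_atTop.mp
    (((((((E1.and E2).and E3).and E4).and E5).and E6).and E7).and (eventually_ge_atTop 1))
  refine ⟨n₀, fun n hn mm hmm a b ep em hep hem ha hb => ?_⟩
  obtain ⟨⟨⟨⟨⟨⟨⟨hE1, hE2⟩, hE3⟩, hE4⟩, hE5⟩, hE6⟩, hE7⟩, hn1⟩ := Hn₀ n hn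
  clear Hn₀ E1 E2 E3 E4 E5 E6 E7 hcM hcC hcA hcD hcCA
  -- basic facts on `n`, `mm`
  have hnR : (1 : ℝ) ≤ n := by exact_mod_cast hn1
  have hn0 : (0 : ℝ) < n := by linarith only [hnR]
  have hmm0 : (0 : ℝ) ≤ mm := Nat.cast_nonneg mm
  have hep0 : (0 : ℝ) ≤ ep := Nat.cast_nonneg ep
  have hem0 : (0 : ℝ) ≤ em := Nat.cast_nonneg em
  have ha0 : (0 : ℝ) ≤ a := Nat.cast_nonneg a
  have hb0 : (0 : ℝ) ≤ b := Nat.cast_nonneg b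
  have hn10 : (n : ℝ) ^ (1 / 10 : ℝ) ≤ n := by
    conv_rhs => rw [← Real.rpow_one (n : ℝ)]
    exact Real.rpow_le_rpow_of_exponent_le hnR (by norm_num)
  have hmmn : (mm : ℝ) ≤ n := le_trans hmm hn10
  have hmmnN : mm ≤ n := by exact_mod_cast hmmn
  have hmm_n : (mm : ℝ) / n ≤ (n : ℝ) ^ (-(9 / 10 : ℝ)) := by
    rw [div_le_iff₀ hn0, show (-(9 / 10 : ℝ)) = 1 / 10 - 1 by norm_num, Real.rpow_sub hn0, Real.rpow_one,
      div_mul_cancel₀ _ hn0.ne']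
    exact hmm
  have hE4a : (n : ℝ) ^ (-(9 / 10 : ℝ)) < χ / 2 := lt_of_lt_of_le hE4 (min_le_left _ _)
  have hE4b : (n : ℝ) ^ (-(9 / 10 : ℝ)) < (1 - pp - pm) / 4 := lt_of_lt_of_le hE4 (min_le_right _ _)
  have hmm9 : (mm : ℝ) ≤ n * (n : ℝ) ^ (-(9 / 10 : ℝ)) := by
    have := (div_le_iff₀ hn0).mp hmm_n; linarith only [this]
  set N := n + mm with hNdef
  have hNn : (N : ℝ) = n + mm := by rw [hNdef]; push_cast; ring
  have hN0 : (0 : ℝ) < N := by rw [hNn]; linarith only [hn0, hmm0]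
  have hnN : (n : ℝ) ≤ N := by rw [hNn]; linarith only [hmm0]
  -- densities
  set α := (a : ℝ) / n with hαdef
  set β := (b : ℝ) / n with hβdef
  set α' := ((a + ep : ℕ) : ℝ) / N with hα'def
  set β' := ((b + em : ℕ) : ℝ) / N with hβ'def
  have haα : (a : ℝ) = n * α := by rw [hαdef]; field_simp
  have hbβ : (b : ℝ) = n * β := by rw [hβdef]; field_simp
  have haα' : ((a + ep : ℕ) : ℝ) = N * α' := by rw [hα'def]; field_simp
  have hbβ' : ((b + em : ℕ) : ℝ) = N * β' := by rw [hβ'def]; field_simp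
  -- `a ≤ n`, `b ≤ n/2`
  have hχsmall : χ ≤ 1 / 8 := by linarith only [hM1, hχM, hpp, hpm]
  have hαle : α ≤ pp + χ := by have := (abs_le.mp ha).2; linarith only [this]
  have hβle : β ≤ pm + χ := by have := (abs_le.mp hb).2; linarith only [this]
  have hα1 : α ≤ 1 := by linarith only [hαle, hχM, hM1, hpm, hpp, hsum]
  have hβ1 : β ≤ 1 / 2 := by linarith only [hβle, hχ3, hlt, hsum]
  have ha_n : (a : ℝ) ≤ n := by
    rw [haα]; nlinarith only [hα1, hn0]
  have hb_n : (b : ℝ) ≤ n / 2 := by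
    rw [hbβ]; nlinarith only [hβ1, hn0]
  have han : a ≤ n := by exact_mod_cast ha_n
  -- shifts of the densities
  have hepR : (ep : ℝ) ≤ mm := by exact_mod_cast hep
  have hemR : (em : ℝ) ≤ mm := by exact_mod_cast hem
  have hshift_gen : ∀ (x e : ℝ), 0 ≤ x → x ≤ n → 0 ≤ e → e ≤ mm →
      |(x + e) / (n + mm) - x / n| ≤ 2 * mm / n := by
    intro x e hx0 hxn he0 hemm
    have eq : (x + e) / (n + mm) - x / n = (n * e - x * mm) / (n * (n + mm)) := by
      field_simp; ring
    rw [eq, abs_div, abs_of_pos (by positivity : (0:ℝ) < n * (n + mm)), div_le_div_iff₀ (by positivity) hn0]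
    have hxm : x * mm ≤ n * mm := mul_le_mul_of_nonneg_right hxn hmm0
    have hne : n * e ≤ n * mm := mul_le_mul_of_nonneg_left hemm hn0.le
    have h1 : |(n : ℝ) * e - x * mm| ≤ 2 * (n * mm) := by
      have hnm : 0 ≤ (n : ℝ) * mm := mul_nonneg hn0.le hmm0
      rw [abs_le]; constructor
      · linarith only [hxm, mul_nonneg hn0.le he0, hnm]
      · linarith only [hne, mul_nonneg hx0 hmm0, hnm]
    have h2 := mul_le_mul_of_nonneg_right h1 hn0.le
    have h3 : 0 ≤ (n : ℝ) * mm * mm := by positivity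
    nlinarith only [h2, h3]
  have hshiftα : |α' - α| ≤ 2 * mm / n := by
    rw [hα'def, hαdef, hNn]; push_cast
    exact hshift_gen a ep ha0 ha_n hep0 hepR
  have hshiftβ : |β' - β| ≤ 2 * mm / n := by
    rw [hβ'def, hβdef, hNn]; push_cast
    exact hshift_gen b em hb0 (by linarith only [hb_n, hn0]) hem0 hemR
  have h2mm : 2 * (mm : ℝ) / n ≤ χ := by
    have e : 2 * (mm : ℝ) / n = 2 * ((mm : ℝ) / n) := by ring
    rw [e]; linarith only [hmm_n, hE4a]
  have ha' : |α' - pp| ≤ 2 * χ := by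
    have := abs_add_le (α' - α) (α - pp)
    rw [show α' - α + (α - pp) = α' - pp by ring] at this; linarith only [this, hshiftα, h2mm, ha]
  have hb' : |β' - pm| ≤ 2 * χ := by
    have := abs_add_le (β' - β) (β - pm)
    rw [show β' - β + (β - pm) = β' - pm by ring] at this; linarith only [this, hshiftβ, h2mm, hb]
  -- the box facts
  obtain ⟨hαm, hβm, hsm⟩ := slyBox (pp := pp) (pm := pm) (α := α) (β := β)
    (by rw [← hM]; linarith only [ha, hχM, hM0]) (by rw [← hM]; linarith only [hb, hχM, hM0])
  obtain ⟨hαm', hβm', hsm'⟩ := slyBox (pp := pp) (pm := pm) (α := α') (β := β')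
    (by rw [← hM]; linarith only [ha', hχM]) (by rw [← hM]; linarith only [hb', hχM])
  rw [← hmL] at hαm hβm hsm hαm' hβm' hsm'
  obtain ⟨⟨hα0, hβ0, hαβ⟩, hPD⟩ := HPD α β (by linarith only [ha, hχ1, hχ₁]) (by linarith only [hb, hχ1, hχ₁])
  obtain ⟨⟨hα0', hβ0', hαβ'⟩, hPD'⟩ := HPD α' β' (by linarith only [ha', hχ1, hχ₁])
    (by linarith only [hb', hχ1, hχ₁])
  have hgap := HGAP α β (by linarith only [ha, hχ2, hχ₂]) (by linarith only [hb, hχ2, hχ₂])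
  have hgap' := HGAP α' β' (by linarith only [ha', hχ2, hχ₂]) (by linarith only [hb', hχ2, hχ₂])
  clear HPD HGAP
  set m := min (min α β) (1 - α - β) with hm
  set m' := min (min α' β') (1 - α' - β') with hm'
  have hmLm : mL ≤ m := le_min (le_min hαm hβm) hsm
  have hmLm' : mL ≤ m' := le_min (le_min hαm' hβm') hsm'
  have hm0 : 0 < m := lt_of_lt_of_le hmL0 hmLm
  have hm0' : 0 < m' := lt_of_lt_of_le hmL0 hmLm'
  have hmpow : ∀ k : ℕ, mL ^ k ≤ m ^ k := fun k => pow_le_pow_left₀ hmL0.le hmLm k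
  have hmpow' : ∀ k : ℕ, mL ^ k ≤ m' ^ k := fun k => pow_le_pow_left₀ hmL0.le hmLm' k
  -- `κ₃ ≤ KU`
  have hK3 : slyK3 α β ≤ KU := slyK3_le hα0 hβ0 hαβ hmL0 hαm hβm hsm
  have hK3' : slyK3 α' β' ≤ KU := slyK3_le hα0' hβ0' hαβ' hmL0 hαm' hβm' hsm'
  -- the point `z` is `δ`-close to `z₀`
  have hθ : |(n : ℝ) / N - 1| ≤ χ / 2 := by
    have e : (n : ℝ) / N - 1 = -((mm : ℝ) / N) := by rw [hNn]; field_simp; ring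
    rw [e, abs_neg, abs_of_nonneg (by positivity)]
    calc (mm : ℝ) / N ≤ mm / n := div_le_div_of_nonneg_left hmm0 hn0 hnN
      _ ≤ χ / 2 := by linarith only [hmm_n, hE4a]
  have hdist : dist ((α, β, α', β', (n : ℝ) / N) : ℝ × ℝ × ℝ × ℝ × ℝ) (pp, pm, pp, pm, 1) < δ := by
    simp only [Prod.dist_eq, Real.dist_eq, max_lt_iff]
    refine ⟨by linarith only [ha, hχδ, hδ0], by linarith only [hb, hχδ, hδ0],
      by linarith only [ha', hχδ, hδ0], by linarith only [hb', hχδ, hδ0], by linarith only [hθ, hχδ, hδ0, hχ0]⟩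
  have hzM := HM (lt_of_lt_of_le hdist (le_trans (min_le_left _ _) (min_le_left _ _)))
  have hzC := HC (lt_of_lt_of_le hdist (le_trans (min_le_left _ _) (min_le_right _ _)))
  have hzA := HA (lt_of_lt_of_le hdist (le_trans (min_le_right _ _) (min_le_left _ _)))
  have hzD := HD (lt_of_lt_of_le hdist (le_trans (min_le_right _ _) (min_le_right _ _)))
  clear HM HC HA HD
  rw [Real.dist_eq] at hzM hzC hzA hzD
  dsimp only at hzC hzA hzD
  obtain ⟨e1, e2, e3⟩ := slySgen_eq_of_eq (q := q) (α := pp) (β := pm)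
  rw [e3] at hzC
  rw [e1] at hzA
  rw [slyDt_one_eq] at hzD
  unfold slyDt at hzD
  rw [abs_lt] at hzC hzA hzD hzM
  have hCt : 0 < slySCgen q ((n : ℝ) / N) α β α' β' := by linarith only [hzC.1, hCp, hκ]
  have hCtU : slySCgen q ((n : ℝ) / N) α β α' β' ≤ CU := by rw [hCU]; linarith only [hzC.2]
  have hAtU : slySAgen q ((n : ℝ) / N) α β α' β' ≤ AU := by rw [hAU]; linarith only [hzA.2]
  have hDt : 0 < slySAgen q ((n : ℝ) / N) α β α' β' * slySCgen q ((n : ℝ) / N) α β α' β' -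
      slySBgen q ((n : ℝ) / N) α β α' β' ^ 2 := by linarith only [hzD.1, hDp0]
  rw [hMCp] at hzM
  -- the `w`-conditions
  set w := (n : ℝ) ^ (-(2 / 5 : ℝ)) with hw
  obtain ⟨-, -, -, w1, w0⟩ := slyW_powers hn1
  have hwη : w ≤ η / κ := le_trans hE3.le (le_trans (min_le_left _ _) (min_le_left _ _))
  have hwm : w ≤ mL ^ 2 / 8 := le_trans hE3.le (le_trans (min_le_left _ _) (min_le_right _ _))
  have hwκ : w ≤ κ * mL ^ 4 / 384 := le_trans hE3.le (min_le_right _ _)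
  -- `μ`
  set μ := ⌊(n : ℝ) * mL ^ 2 / 4⌋₊ + 1 with hμdef
  have hμ1 : 1 ≤ μ := by omega
  have hμlo : (n : ℝ) * mL ^ 2 / 4 ≤ μ := by
    rw [hμdef]; push_cast; exact (Nat.lt_floor_add_one _).le
  have hfl := Nat.floor_le (show (0:ℝ) ≤ n * mL ^ 2 / 4 by positivity)
  have h4n : 4 ≤ (n : ℝ) * mL ^ 2 := by
    have := (div_le_iff₀ (by positivity : (0:ℝ) < mL ^ 2)).mp hE6; linarith only [this]
  have hμhi : (μ : ℝ) ≤ n * (m ^ 2 / 2) := by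
    rw [hμdef]; push_cast
    have := mul_le_mul_of_nonneg_left (hmpow 2) hn0.le
    linarith only [hfl, h4n, this]
  have hμhi' : (μ : ℝ) ≤ N * (m' ^ 2 / 2) := by
    rw [hμdef]; push_cast
    have := mul_le_mul hnN (hmpow' 2) (by positivity) hN0.le
    linarith only [hfl, h4n, this]
  -- counting conditions
  have hb2 : b + b ≤ n := by
    have : (b : ℝ) + b ≤ n := by linarith only [hb_n]
    exact_mod_cast this
  have habN : a + b < n := by
    have : (a : ℝ) + b < n := by
      rw [haα, hbβ]
      have := mul_lt_mul_of_pos_left hαβ hn0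
      linarith only [this]
    exact_mod_cast this
  have hb2' : (b + em) + (b + em) ≤ N := by
    have h1 : (b : ℝ) ≤ n * (pm + χ) := by rw [hbβ]; exact mul_le_mul_of_nonneg_left hβle hn0.le
    have h7 := mul_lt_mul_of_pos_left hE7 hn0
    have h8 := mul_le_mul_of_nonneg_left hχ3 hn0.le
    have : ((b : ℝ) + em) + (b + em) ≤ n + mm := by linarith only [h1, hemR, hmm9, h7, h8]
    have : ((b + em) + (b + em) : ℕ) ≤ N := by rw [hNdef]; exact_mod_cast this
    exact this
  have habN' : (a + ep) + (b + em) < N := by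
    have h1 : (a : ℝ) + b ≤ n * (pp + χ) + n * (pm + χ) := by
      rw [haα, hbβ]
      linarith only [mul_le_mul_of_nonneg_left hαle hn0.le, mul_le_mul_of_nonneg_left hβle hn0.le]
    have hχq : 2 * χ ≤ (1 - pp - pm) / 4 := by linarith only [hM1, hχM]
    have h9 := mul_lt_mul_of_pos_left hE4b hn0
    have h10 := mul_le_mul_of_nonneg_left hχq hn0.le
    have : ((a : ℝ) + ep) + (b + em) < n + mm := by linarith only [h1, h10, hepR, hemR, hmm9, h9]
    have : ((a + ep) + (b + em) : ℕ) < N := by rw [hNdef]; exact_mod_cast this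
    exact this
  -- the shift condition `40 mm ≤ c₀ w N`
  have hshift : 40 * (mm : ℝ) ≤ c₀ * w * N := by
    have h1 : 40 * (mm : ℝ) ≤ 40 * (n : ℝ) ^ (1 / 10 : ℝ) := by linarith only [hmm]
    have h2 : 40 ≤ c₀ * (n : ℝ) ^ (1 / 2 : ℝ) := by
      have := (div_le_iff₀ hc₀0).mp hE5; linarith only [this]
    have h3 : c₀ * (n : ℝ) ^ (1 / 2 : ℝ) * (n : ℝ) ^ (1 / 10 : ℝ) = c₀ * w * n := by
      have ea : (n : ℝ) ^ (1 / 2 : ℝ) * (n : ℝ) ^ (1 / 10 : ℝ) = (n : ℝ) ^ (3 / 5 : ℝ) := by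
        rw [← Real.rpow_add hn0]; norm_num
      have eb : w * n = (n : ℝ) ^ (3 / 5 : ℝ) := by
        rw [hw]
        conv_lhs => rw [show (n : ℝ) ^ (-(2 / 5 : ℝ)) * n = (n : ℝ) ^ (-(2 / 5 : ℝ)) * (n : ℝ) ^ (1 : ℝ) by
          rw [Real.rpow_one]]
        rw [← Real.rpow_add hn0]; norm_num
      rw [mul_assoc, ea, mul_assoc, eb]
    have h4 : 0 ≤ (n : ℝ) ^ (1 / 10 : ℝ) := by positivity
    calc 40 * (mm : ℝ) ≤ 40 * (n : ℝ) ^ (1 / 10 : ℝ) := h1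
      _ ≤ c₀ * (n : ℝ) ^ (1 / 2 : ℝ) * (n : ℝ) ^ (1 / 10 : ℝ) := mul_le_mul_of_nonneg_right h2 h4
      _ = c₀ * w * n := h3
      _ ≤ c₀ * w * N := mul_le_mul_of_nonneg_left hnN (by positivity)
  -- the smallness conditions
  have hd : ((q + 1 : ℕ) : ℝ) = (q : ℝ) + 1 := by push_cast; ring
  have h47 : (0 : ℝ) < 4 + 7 * ((q + 1 : ℕ) : ℝ) := by positivity
  have hr₀1 : 3 * r₀ ≤ m ^ 2 / 2 := by
    have : r₀ ≤ mL ^ 2 / 6 := min_le_left _ _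
    linarith only [this, hmpow 2]
  have hr₀1' : 3 * r₀ ≤ m' ^ 2 / 2 := by
    have : r₀ ≤ mL ^ 2 / 6 := min_le_left _ _
    linarith only [this, hmpow' 2]
  have hr₀2 : r₀ ≤ κ * mL ^ 4 / (648 * (4 + 7 * ((q + 1 : ℕ) : ℝ))) := min_le_right _ _
  have hr₀3 : 12 * (4 + 7 * ((q + 1 : ℕ) : ℝ)) * (27 * r₀) ≤ κ / 2 * mL ^ 4 := by
    have := (le_div_iff₀ (by positivity : (0:ℝ) < 648 * (4 + 7 * ((q + 1 : ℕ) : ℝ)))).mp hr₀2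
    linarith only [this]
  have hκmL : 0 ≤ κ * mL ^ 4 := by positivity
  have hr₀4 : 12 * (4 + 7 * ((q + 1 : ℕ) : ℝ)) * (8 * r₀) ≤ κ / 4 * mL ^ 4 := by linarith only [hr₀3, hκmL]
  have hκm4 : κ / 4 * mL ^ 4 ≤ κ / 4 * m ^ 4 := mul_le_mul_of_nonneg_left (hmpow 4) (by positivity)
  have hκm4' : κ / 4 * mL ^ 4 ≤ κ / 4 * m' ^ 4 := mul_le_mul_of_nonneg_left (hmpow' 4) (by positivity)
  have hκm2 : κ / 2 * mL ^ 4 ≤ κ / 2 * m ^ 4 := mul_le_mul_of_nonneg_left (hmpow 4) (by positivity)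
  have hκm2' : κ / 2 * mL ^ 4 ≤ κ / 2 * m' ^ 4 := mul_le_mul_of_nonneg_left (hmpow' 4) (by positivity)
  -- `hQ`, `hQ'`
  have hQgen : ∀ {mm5 : ℝ}, mL ^ 5 ≤ mm5 → 0 < mm5 → ∀ t : ℝ, t ≤ 4 * c₀ → 0 ≤ t →
      3 * (((q + 1 : ℕ) : ℝ) + 2) / mm5 * t * c₀ ≤ κ / 8 := by
    intro mm5 hm5 hm50 t ht ht0
    rw [hd, show (q : ℝ) + 1 + 2 = (q : ℝ) + 3 by ring]
    have h1 : 3 * ((q : ℝ) + 3) / mm5 ≤ 3 * ((q : ℝ) + 3) / mL ^ 5 :=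
      div_le_div_of_nonneg_left (by positivity) (by positivity) hm5
    have h2 : c₀ * (96 * ((q : ℝ) + 3)) ≤ κ * mL ^ 5 := (le_div_iff₀ (by positivity)).mp hc₀κ
    have hcc : c₀ * c₀ ≤ c₀ := by nlinarith only [hc₀0, hc₀1]
    have h3 : 3 * ((q : ℝ) + 3) / mL ^ 5 * (4 * c₀) * c₀ ≤ κ / 8 := by
      rw [div_mul_eq_mul_div, div_mul_eq_mul_div, div_le_iff₀ (by positivity)]
      have := mul_le_mul_of_nonneg_left hcc hq3.le
      linarith only [this, h2]
    calc 3 * ((q : ℝ) + 3) / mm5 * t * c₀ ≤ 3 * ((q : ℝ) + 3) / mL ^ 5 * (4 * c₀) * c₀ := by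
          apply mul_le_mul_of_nonneg_right _ hc₀0.le
          exact mul_le_mul h1 ht ht0 (by positivity)
      _ ≤ κ / 8 := h3
  have hQ : 3 * (((q + 1 : ℕ) : ℝ) + 2) / m ^ 5 * c₀ ^ 2 ≤ κ / 8 := by
    have := hQgen (hmpow 5) (by positivity) c₀ (by linarith only [hc₀0]) hc₀0.le
    rw [sq, ← mul_assoc]; exact this
  have hQ' : 3 * (((q + 1 : ℕ) : ℝ) + 2) / m' ^ 5 * (2 * c₀) ^ 2 ≤ κ / 8 := by
    have := hQgen (hmpow' 5) (by positivity) (4 * c₀) le_rfl (by positivity)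
    rw [show (2 * c₀) ^ 2 = 4 * c₀ * c₀ by ring, ← mul_assoc]; exact this
  -- `hcube`, `hcube'`
  have hκm8 : κ / 8 * mL ^ 4 ≤ κ / 8 * m ^ 4 := mul_le_mul_of_nonneg_left (hmpow 4) (by positivity)
  have hκm8' : κ / 8 * mL ^ 4 ≤ κ / 8 * m' ^ 4 := mul_le_mul_of_nonneg_left (hmpow' 4) (by positivity)
  have hcube : 48 * c₀ ^ 3 * w ≤ κ / 8 * m ^ 4 := by
    have h1 : c₀ ^ 3 ≤ 1 := pow_le_one₀ hc₀0.le hc₀1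
    have h2 := mul_le_mul_of_nonneg_right h1 w0.le
    linarith only [h2, hwκ, hκm8]
  have hcube' : 48 * (2 * c₀) ^ 3 * w ≤ κ / 8 * m' ^ 4 := by
    have h1 : (2 * c₀) ^ 3 ≤ 1 := pow_le_one₀ (by positivity) (by linarith only [hc₀h])
    have h2 := mul_le_mul_of_nonneg_right h1 w0.le
    linarith only [h2, hwκ, hκm8']
  -- `hηw`, `hw2`
  have hηw : κ * w ^ 2 ≤ η := by
    have h1 : w ^ 2 ≤ w := by nlinarith only [w0, w1]
    have h2 : κ * w ≤ η := (le_div_iff₀' hκ).mp hwη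
    have h3 := mul_le_mul_of_nonneg_left h1 hκ.le
    linarith only [h2, h3]
  have hw2 : 2 * w ≤ m ^ 2 / 4 := by linarith only [hwm, hmpow 2]
  have hw2' : 2 * w ≤ m' ^ 2 / 4 := by linarith only [hwm, hmpow' 2]
  -- apply the explicit bound
  have hex := slyRatioGen_le_explicit q (n := n) (N := N) (mm := mm) (a := a) (b := b) (ep := ep) (em := em)
    (μ := μ) (μ' := μ) (m := m) (m' := m') (κ := κ) (η := η) (η' := η) (r₀ := r₀) (w := w) (c₀ := c₀)
    hn1 hNdef hep hem hmmnN hb2 habN hb2' habN' haα hbβ hα0 hβ0 hαβ haα' hbβ' hα0' hβ0' hαβ' hm hm'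
    hκ w0 hc₀0 (by linarith only [hc₀h]) hPD hPD' hgap hgap' hr₀1 hr₀1' (le_trans hr₀4 hκm4)
    (le_trans hr₀4 hκm4') (le_trans hr₀3 hκm2) (le_trans hr₀3 hκm2') hQ hQ' hcube hcube' hηw hηw hw2 hw2'
    hμ1 hμhi hμ1 hμhi' hshift hCt hDt
  have hcmp := slyExplicitRHS_le (q := q) (mL := mL) (κ := κ) (c₀ := c₀) (KU := KU) (CU := CU) (AU := AU)
    (n := n) (N := N) (mm := mm) (μ := μ) (μ' := μ) (α := α) (β := β) (α' := α') (β' := β') (m := m) (m' := m')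
    (w := w) hn1 hw rfl hNdef hmmnN hmm hα0 hβ0 hαβ hα0' hβ0' hαβ' hmL0 hmLm hmLm' hκ hc₀0 hc₀1 hμlo hK3 hK3'
    hCt hDt hCtU hAtU
  have htot := le_trans hex hcmp
  clear hex hcmp
  -- numerics
  have hMCle : slyMainConst q (α, β, α', β', (n : ℝ) / N) ≤ τ + τ * ε' / 4 := by linarith only [hzM.2]
  have hErr0 : 0 ≤ slyErrU q mL κ c₀ KU CU AU n := slyErrU_nonneg hKU0 hCU0 hAU0 n
  have key : (1 + ε') * τ - ((τ + τ * ε' / 4) * (1 + ε' / 4) + τ * ε' / 4) = τ * ε' * (4 - ε') / 16 := by ring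
  have hkey0 : 0 ≤ τ * ε' * (4 - ε') / 16 := by
    have := mul_nonneg (mul_nonneg hτ0.le hε'0.le) (sub_nonneg.mpr hε'4)
    positivity
  calc slyRatioGen n N q a b ep em
      ≤ slyMainConst q (α, β, α', β', (n : ℝ) / N) * slyErrU q mL κ c₀ KU CU AU n + slyFarU q κ c₀ n := htot
    _ ≤ (τ + τ * ε' / 4) * (1 + ε' / 4) + τ * ε' / 4 := by
        apply add_le_add _ hE2.le
        exact mul_le_mul hMCle hE1.le hErr0 (by positivity)
    _ ≤ (1 + ε') * τ := by linarith only [key, hkey0]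
    _ ≤ (1 + ε) * τ := mul_le_mul_of_nonneg_right (by linarith only [hε'ε]) hτ0.le

end Final

end Literature.Computability.Complexity
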